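import Literature.Computability.FineGrained.SparsifierTheta
import Literature.Computability.FineGrained.IPLemma2Assembly
import Literature.Computability.Complexity.TokenStreams
import HarnessLib

/-!
# Compaction of k-CNFs is polynomial-time: the machine

Family `fine-grained` (trunk T-CPLX-FINE). This file DISCHARGES the named fact
`Literature.Computability.FineGrained.kCNF_compact_computable` of `IPLemma2Assembly.lean`
(`kCNF_compact_computable_holds`): the compaction `KCNF.compact` — rename the occurring
variables of a k-CNF by their order of first occurrence and reset `numVars` to their number,
the preprocessing of the assembly of Impagliazzo–Paturi's Lemma 2 (`impagliazzoPaturi_lemma2_of`)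
— is computed from `KCNF.encode` to `KCNF.encode` by a multi-stack machine within
`80 (L + 1)^4` steps. The machine is a structured stack program over the alphabet `Γ'` of the
encoding (`Literature.Computability.Complexity.ACom`, `SymbolPrograms.lean`; exact step counts, compiled to Mathlib's
`Turing.FinTM2` by `ACom.exists_computesInTime`) on the register file and with the literal and
clause routines of the sparsification program (`SparsifierRoutines.lean`: `litPass`, `famPass`,
`eqXY`, word encodings `litBody`/`cbody`/`wFam`; `SparsifierTheta.lean`: `length_cbody_le`).

Relation to the brute-force decider: the renaming stage of `SATBruteForceRename.lean`
(`BruteForce.renFST`, `pivots`) ranks the occurring variables in the same first-occurrence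
order (`pivots` there, `IPRename.occList` / `pvars` here), but inside a transducer state word
with *unary* ranks (cell blocks `pre^j mark post^(v-1-j)`) feeding the counting stage; the fact
discharged here asks for the output in the input format `KCNF.encode` (binary header `numVars`,
binary indices), which that pipeline never materialises, so a direct one-pass dictionary
program is both shorter and gives the polynomial bound `80 (L+1)^4` with explicit constants.

## The program (`Compaction.prog`)

The input `bits n ++ comma :: wFam F` is read once (`hdrBody`: header digits are dropped; at
the comma the clauses are processed, `clauseAct` per clause through `famPass`, `litAct` per
literal through `litPass`). A dictionary register `d` holds, for the variables met so far in
the order of first occurrence `x₀, x₁, …`, the literals `(x₀, true), (0, false), (x₁, true),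
(1, false), …` (`dictLits`), and a counter register `cnt` their number in binary (`bits m`,
Mathlib's `encodeNat`, incremented by the carry pass `incr` = `TokConv.incRes`). At a literal
`(x, b)`: the polarity digit is emitted, the probe is normalised to `(x, true)` and looked up
(`lookup`: one `litPass` over the dictionary comparing index literals with `eqXY` and, at the
rank literal following a hit, emitting the rank digits); a new variable gets the counter as its
rank, its entry is appended to the dictionary and the counter is incremented (`newEntry`). The
renamed clauses accumulate reversed on `acc`; `finish` writes counter, comma and clauses to the
output register.

## Proof architecture

Each routine has a `runs_*` specification (effect on the store as `Function.update`s, and a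
cost polynomial: `cLookAct`, `cLookup`, `cNewEntry`, `cLitAct`, `cClause`, `cProg`); loops over
words are instances of `runs_litPass` / `runs_famPass` with explicit invariants (`lkSt` for the
lookup — as a function of the number of processed dictionary literals only: toggle, `found`,
`h`(it), emitted rank; `StL` for a clause body; `StF` for the clause list). The list-level model
of the renaming (`pvars` = `List.eraseDups` of the variables, `rk`, `outLits`, `outF`) is
identified with `IPRename.occList` / `KCNF.compact` by `eraseDups_append_singleton`,
`idxOf_eraseDups_append` (ranks assigned online are final), `outF_eq_map`, `occList_eq_pvars`.
Sizes: every register stays polynomial in `L` (`GoodW`, `length_*_le_wFam`), the total cost is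
`cProg L = 74 L⁴ + 284 L³ + 195 L² + 48 L + 10 ≤ 80 (L+1)⁴` (`cProg_le`).

## References

* R. Impagliazzo, R. Paturi, *On the complexity of k-SAT*, JCSS 62 (2001) 367–375, Lemma 2
  (the reduction whose assembly uses the compaction; `IPLemma2Assembly.lean`).
* S. Arora, B. Barak, *Computational Complexity: A Modern Approach*, CUP 2009, §1.3 (multi-tape
  machine constructions).
* D. E. Knuth, *The Art of Computer Programming*, vol. 2: *Seminumerical Algorithms*, 3rd ed.,
  Addison-Wesley 1997, §4.3.1 (addition with carry; the counter increment `incr`).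
-/

namespace Literature.Computability.FineGrained.Compaction

open _root_.Computability Complexity Complexity.ACom Sparsifier

/-! ### Binary numerals in a register -/

/-- The word of a binary numeral (Mathlib's `encodeNat`, least significant digit first).
[folklore] -/
def bits (n : ℕ) : List Γ' := (encodeNat n).map Γ'.bit

/-- The word of a list of Boolean digits. [folklore] -/
def bw (w : List Bool) : List Γ' := w.map Γ'.bit

/-- The empty word. [folklore] -/
@[simp] theorem bw_nil : bw [] = [] := rfl
/-- A digit and a word. [folklore] -/
@[simp] theorem bw_cons (b : Bool) (w : List Bool) : bw (b :: w) = Γ'.bit b :: bw w := rfl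
/-- Concatenation of words. [folklore] -/
theorem bw_append (u v : List Bool) : bw (u ++ v) = bw u ++ bw v := by simp [bw]
/-- Length of a word. [folklore] -/
@[simp] theorem length_bw (w : List Bool) : (bw w).length = w.length := by simp [bw]
/-- Numerals are words. [folklore] -/
theorem bits_eq_bw (n : ℕ) : bits n = bw (encodeNat n) := rfl

/-- `litBody (i, b) = bit b :: bits i`. [folklore] -/
theorem litBody_eq (l : Lit) : litBody l = Γ'.bit l.2 :: bits l.1 := rfl

/-! ### Binary increment -/

/-- A Boolean flag register: `[blank]` for `true`, `[]` for `false`. [folklore] -/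
def uflag (b : Bool) : List Γ' := bif b then [Γ'.blank] else []

/-- The raised flag. [folklore] -/
@[simp] theorem uflag_true : uflag true = [Γ'.blank] := rfl
/-- The lowered flag. [folklore] -/
@[simp] theorem uflag_false : uflag false = [] := rfl

/-- Body of the increment loop over `cnt` (carry flag in `fl`, result reversed on `j1`):
digit `b` with carry `c` gives digit `b xor c` and carry `b and c`. [folklore] -/
def incBody (a : Γ') : Prog :=
  pop K.fl fun o => match o with
    | some _ => (match a with
        | Γ'.bit true => push K.j1 (Γ'.bit false) ;; push K.fl Γ'.blank
        | _ => push K.j1 (Γ'.bit true))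
    | none => push K.j1 a

/-- `incr`: replace the numeral `w` in `cnt` by `TokConv.incRes true w` (so `bits n` becomes
`bits (n + 1)`, `TokConv.encodeNat_succ_eq_incRes`). Requires `fl = j1 = []`.
(Schoolbook binary increment with carry, least significant digit first.) [folklore] -/
def incr : Prog :=
  push K.fl Γ'.blank ;; loop K.cnt incBody ;;
  pop K.fl (fun o => match o with
    | some _ => push K.j1 (Γ'.bit true)
    | none => skip) ;;
  pour K.j1 K.cnt

/-- The increment loop computes the carry pass (`TokConv.ib`, `TokConv.co`). [folklore] -/
theorem runs_incLoop : ∀ (w : List Bool) (c : Bool) (R : Store), R K.cnt = bw w →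
    R K.fl = uflag c →
    Runs (loop K.cnt incBody) R
      (Function.update (Function.update (Function.update R K.cnt []) K.fl
        (uflag (TokConv.co c w))) K.j1 ((bw (TokConv.ib c w)).reverse ++ R K.j1))
      (6 * w.length + 1)
  | [], c, R, hcnt, hfl => by
    refine (Runs.loop_nil incBody (R := R) hcnt).of_eq ?_ (by simp)
    funext r
    rcases eq_or_ne r K.j1 with rfl | h1
    · simp [TokConv.ib]
    rcases eq_or_ne r K.fl with rfl | h2
    · simp [TokConv.co, hfl]
    rcases eq_or_ne r K.cnt with rfl | h3
    · simp [hcnt]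
    simp [h1, h2, h3]
  | b :: w, c, R, hcnt, hfl => by
    rw [bw_cons] at hcnt
    -- the store after the body
    set R₁ : Store := Function.update (Function.update (Function.update R K.cnt (bw w)) K.fl
      (uflag (b && c))) K.j1 (Γ'.bit (b ^^ c) :: R K.j1) with hR₁
    have hbody : Runs (incBody (Γ'.bit b)) (Function.update R K.cnt (bw w)) R₁ 4 := by
      unfold incBody
      cases c with
      | false =>
        have hk : Function.update R K.cnt (bw w) K.fl = [] := by simp [hfl]
        refine (Runs.pop_nil hk (Runs.push' ?_)).mono (by norm_num)
        rw [hR₁]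
        funext r
        rcases eq_or_ne r K.j1 with rfl | h1
        · simp
        rcases eq_or_ne r K.fl with rfl | h2
        · simp [hfl]
        · simp [h1, h2]
      | true =>
        have hk : Function.update R K.cnt (bw w) K.fl = Γ'.blank :: [] := by simp [hfl]
        cases b with
        | true =>
          have hin : Runs (push K.j1 (Γ'.bit false) ;; push K.fl Γ'.blank)
              (Function.update (Function.update R K.cnt (bw w)) K.fl []) R₁ 2 := by
            refine ((Runs.push K.j1 (Γ'.bit false) _).seq (Runs.push' ?_)).of_eq rfl (by norm_num)
            rw [hR₁]
            funext r
            rcases eq_or_ne r K.fl with rfl | h2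
            · simp
            rcases eq_or_ne r K.j1 with rfl | h1
            · simp
            · simp [h1, h2]
          exact (Runs.pop_cons hk hin).mono (by norm_num)
        | false =>
          have hin : Runs (push K.j1 (Γ'.bit true))
              (Function.update (Function.update R K.cnt (bw w)) K.fl []) R₁ 1 := by
            refine Runs.push' ?_
            rw [hR₁]
            funext r
            rcases eq_or_ne r K.j1 with rfl | h1
            · simp
            rcases eq_or_ne r K.fl with rfl | h2
            · simp
            · simp [h1, h2]
          exact (Runs.pop_cons hk hin).mono (by norm_num)
    have ih := runs_incLoop w (b && c) R₁ (by simp [hR₁]) (by simp [hR₁])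
    refine (Runs.loop_cons hcnt hbody ih).of_eq ?_ ?_
    · rw [hR₁]
      funext r
      rcases eq_or_ne r K.j1 with rfl | h1
      · simp [TokConv.ib]
      rcases eq_or_ne r K.fl with rfl | h2
      · simp [TokConv.co]
      rcases eq_or_ne r K.cnt with rfl | h3
      · simp
      simp [h1, h2, h3]
    · simp only [List.length_cons]; omega

/-- **Specification of `incr`.** With `cnt = bw w` and `fl = j1 = []`, `incr` sets `cnt` to
`bw (incRes true w)` within `9 |w| + 9` steps. [folklore] -/
theorem runs_incr (w : List Bool) (R : Store) (hcnt : R K.cnt = bw w) (hfl : R K.fl = [])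
    (hj1 : R K.j1 = []) :
    Runs incr R (Function.update R K.cnt (bw (TokConv.incRes true w))) (9 * w.length + 9) := by
  unfold incr
  have e1 := Runs.push K.fl Γ'.blank R
  rw [hfl] at e1
  have e2 := runs_incLoop w true (Function.update R K.fl [Γ'.blank]) (by simp [hcnt])
    (by simp)
  set R₂ : Store := Function.update (Function.update (Function.update R K.cnt []) K.fl
    (uflag (TokConv.co true w))) K.j1 (bw (TokConv.ib true w)).reverse with hR₂
  have e2' : Runs (loop K.cnt incBody) (Function.update R K.fl [Γ'.blank]) R₂ (6 * w.length + 1) := by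
    refine e2.of_eq ?_ le_rfl
    rw [hR₂]
    funext r
    rcases eq_or_ne r K.j1 with rfl | h1
    · simp [hj1]
    rcases eq_or_ne r K.fl with rfl | h2
    · simp
    rcases eq_or_ne r K.cnt with rfl | h3
    · simp
    simp [h1, h2, h3]
  -- the final carry
  set R₃ : Store := Function.update (Function.update (Function.update R K.cnt []) K.fl [])
    K.j1 (bw (TokConv.incRes true w)).reverse with hR₃
  have e3 : Runs (pop K.fl fun o => match o with
      | some _ => push K.j1 (Γ'.bit true)
      | none => skip) R₂ R₃ 3 := by
    cases hco : TokConv.co true w with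
    | true =>
      have hk : R₂ K.fl = Γ'.blank :: [] := by simp [hR₂, hco]
      refine (Runs.pop_cons hk (Runs.push' ?_)).mono (by norm_num)
      rw [hR₃, hR₂]
      funext r
      rcases eq_or_ne r K.j1 with rfl | h1
      · simp [TokConv.incRes, hco, Literature.Computability.Complexity.flag, bw_append]
      rcases eq_or_ne r K.fl with rfl | h2
      · simp
      simp [h1, h2]
    | false =>
      have hk : R₂ K.fl = [] := by simp [hR₂, hco]
      refine (Runs.pop_nil hk ((Runs.skip _).of_eq ?_ le_rfl)).mono (by norm_num)
      rw [hR₃, hR₂]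
      funext r
      rcases eq_or_ne r K.j1 with rfl | h1
      · simp [TokConv.incRes, hco, Literature.Computability.Complexity.flag]
      rcases eq_or_ne r K.fl with rfl | h2
      · simp [hco]
      simp [h1, h2]
  have e4 := runs_pour (a := K.j1) (b := K.cnt) (by decide) R₃
  have hR₃j1 : R₃ K.j1 = (bw (TokConv.incRes true w)).reverse := by simp [hR₃]
  have hR₃cnt : R₃ K.cnt = [] := by simp [hR₃]
  rw [hR₃j1, hR₃cnt, List.length_reverse, List.reverse_reverse, List.append_nil] at e4
  refine (e1.seq (e2'.seq (e3.seq e4))).of_eq ?_ ?_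
  · rw [hR₃]
    funext r
    rcases eq_or_ne r K.cnt with rfl | h3
    · simp
    rcases eq_or_ne r K.j1 with rfl | h1
    · simp [hj1]
    rcases eq_or_ne r K.fl with rfl | h2
    · simp [hfl]
    simp [h1, h2, h3]
  · have := TokConv.length_incRes_le true w
    simp only [length_bw]
    omega

/-- `incr` on a numeral: `bits n ↦ bits (n + 1)`. [folklore] -/
theorem runs_incr_bits (n : ℕ) (R : Store) (hcnt : R K.cnt = bits n) (hfl : R K.fl = [])
    (hj1 : R K.j1 = []) :
    Runs incr R (Function.update R K.cnt (bits (n + 1))) (9 * n + 9) := by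
  have h := runs_incr (encodeNat n) R hcnt hfl hj1
  rw [← TokConv.encodeNat_succ_eq_incRes] at h
  exact h.mono (by have := TokConv.length_encodeNat_le n; omega)

/-! ### Emitting the counter -/

/-- `emitCnt dst`: push the symbols of `cnt` in reading order onto `dst`, keeping `cnt`
(`dst := (cnt).reverse ++ dst`). Requires `j1 = j2 = j3 = []`. [folklore] -/
def emitCnt (dst : K) : Prog :=
  copy2 K.cnt K.j1 K.j2 ;; pour K.j1 K.cnt ;; pour K.j2 K.j3 ;; pour K.j3 dst

/-- Effect and cost of `emitCnt`. [folklore] -/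
theorem runs_emitCnt {dst : K} (hd : dst ≠ K.cnt) (hd1 : dst ≠ K.j1) (hd2 : dst ≠ K.j2)
    (hd3 : dst ≠ K.j3) (R : Store) (hj1 : R K.j1 = []) (hj2 : R K.j2 = []) (hj3 : R K.j3 = []) :
    Runs (emitCnt dst) R (Function.update R dst ((R K.cnt).reverse ++ R dst))
      (13 * (R K.cnt).length + 4) := by
  unfold emitCnt
  set v := R K.cnt with hv
  have e1 := runs_copy2 (a := K.cnt) (b := K.j1) (c := K.j2) (by decide) (by decide) (by decide) R
  rw [← hv, hj1, hj2, List.append_nil] at e1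
  set R₁ : Store := Function.update (Function.update (Function.update R K.cnt []) K.j1 v.reverse)
    K.j2 v.reverse with hR₁
  have e2 := runs_pour (a := K.j1) (b := K.cnt) (by decide) R₁
  have h1 : R₁ K.j1 = v.reverse := by simp [hR₁]
  have h2 : R₁ K.cnt = [] := by simp [hR₁]
  rw [h1, h2, List.length_reverse, List.reverse_reverse, List.append_nil] at e2
  set R₂ : Store := Function.update (Function.update R₁ K.j1 []) K.cnt v with hR₂
  have e3 := runs_pour (a := K.j2) (b := K.j3) (by decide) R₂
  have h3 : R₂ K.j2 = v.reverse := by simp [hR₂, hR₁]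
  have h4 : R₂ K.j3 = [] := by simp [hR₂, hR₁, hj3]
  rw [h3, h4, List.length_reverse, List.reverse_reverse, List.append_nil] at e3
  set R₃ : Store := Function.update (Function.update R₂ K.j2 []) K.j3 v with hR₃
  have e4 := runs_pour (a := K.j3) (b := dst) hd3.symm R₃
  have h5 : R₃ K.j3 = v := by simp [hR₃]
  have h6 : R₃ dst = R dst := by
    simp [hR₃, hR₂, hR₁, Function.update_of_ne hd, Function.update_of_ne hd1,
      Function.update_of_ne hd2, Function.update_of_ne hd3]
  rw [h5, h6] at e4
  refine (e1.seq (e2.seq (e3.seq e4))).of_eq ?_ (by omega)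
  rw [hR₃, hR₂, hR₁]
  funext r
  rcases eq_or_ne r dst with rfl | h0
  · simp
  rcases eq_or_ne r K.j3 with rfl | h7
  · simp [Function.update_of_ne hd3.symm, hj3]
  rcases eq_or_ne r K.j2 with rfl | h8
  · simp [Function.update_of_ne hd2.symm, hj2]
  rcases eq_or_ne r K.cnt with rfl | h9
  · simp [Function.update_of_ne hd.symm, hv]
  rcases eq_or_ne r K.j1 with rfl | h10
  · simp [Function.update_of_ne hd1.symm, hj1]
  simp [h0, h7, h8, h9, h10]

/-! ### The dictionary of ranked variables -/

/-- The dictionary literals for the known variables `vs` (in order of first occurrence) with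
ranks from `j` on: variable `x` of rank `r` contributes the two literals `(x, true), (r, false)`.
[folklore] -/
def dictLits : ℕ → List ℕ → List Lit
  | _, [] => []
  | j, x :: vs => (x, true) :: (j, false) :: dictLits (j + 1) vs

/-- The empty dictionary. [folklore] -/
@[simp] theorem dictLits_nil (j : ℕ) : dictLits j [] = [] := rfl
/-- The first entry of a dictionary. [folklore] -/
theorem dictLits_cons (j x : ℕ) (vs : List ℕ) :
    dictLits j (x :: vs) = (x, true) :: (j, false) :: dictLits (j + 1) vs := rfl

/-- The dictionary has two literals per variable. [folklore] -/
@[simp] theorem length_dictLits : ∀ (j : ℕ) (vs : List ℕ), (dictLits j vs).length = 2 * vs.length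
  | _, [] => rfl
  | j, x :: vs => by simp [dictLits_cons, length_dictLits (j + 1) vs]; ring

/-- Appending a variable appends its entry. [folklore] -/
theorem dictLits_append_singleton : ∀ (j : ℕ) (vs : List ℕ) (x : ℕ),
    dictLits j (vs ++ [x]) = dictLits j vs ++ [(x, true), (j + vs.length, false)]
  | j, [], x => by simp [dictLits]
  | j, v :: vs, x => by
    simp only [List.cons_append, dictLits_cons, dictLits_append_singleton (j + 1) vs x,
      List.length_cons, List.cons.injEq, true_and]
    congr 2
    simp only [List.cons.injEq, and_true, Prod.mk.injEq]
    omega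

/-- The literal at a split of the dictionary: an index literal at even positions, a rank
literal at odd positions. [folklore] -/
theorem dictLits_split : ∀ (vs : List ℕ) (j : ℕ) (done rest : List Lit) (l : Lit),
    done ++ l :: rest = dictLits j vs →
      (done.length % 2 = 0 ∧ l.2 = true ∧ vs[done.length / 2]? = some l.1) ∨
      (done.length % 2 = 1 ∧ l = (j + done.length / 2, false))
  | [], j, done, rest, l, h => by
    have := congrArg List.length h
    simp at this
  | x :: vs, j, [], rest, l, h => by
    simp only [dictLits_cons, List.nil_append, List.cons.injEq] at h
    left; simp [h.1]
  | x :: vs, j, [a], rest, l, h => by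
    simp only [dictLits_cons, List.singleton_append, List.cons.injEq] at h
    right; simp [h.2.1]
  | x :: vs, j, a :: b :: done, rest, l, h => by
    simp only [dictLits_cons, List.cons_append, List.cons.injEq] at h
    have e : (a :: b :: done).length / 2 = done.length / 2 + 1 := by
      simp only [List.length_cons]; omega
    rw [e]
    rcases dictLits_split vs (j + 1) done rest l h.2.2 with ⟨h1, h2, h3⟩ | ⟨h1, h2⟩
    · left
      exact ⟨by simp only [List.length_cons]; omega, h2, by simpa using h3⟩
    · right
      refine ⟨by simp only [List.length_cons]; omega, ?_⟩
      rw [h2]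
      simp only [Prod.mk.injEq, and_true]
      omega

/-- Members of the dictionary. [folklore] -/
theorem mem_dictLits : ∀ (j : ℕ) (vs : List ℕ) (l : Lit), l ∈ dictLits j vs →
    (l.2 = true ∧ l.1 ∈ vs) ∨ (l.2 = false ∧ l.1 < j + vs.length)
  | _, [], l, h => by simp at h
  | j, x :: vs, l, h => by
    simp only [dictLits_cons, List.mem_cons] at h
    rcases h with rfl | rfl | h
    · left; simp
    · right; simp
    · rcases mem_dictLits (j + 1) vs l h with ⟨h1, h2⟩ | ⟨h1, h2⟩
      · left; exact ⟨h1, List.mem_cons_of_mem _ h2⟩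
      · right; exact ⟨h1, by simp only [List.length_cons]; omega⟩

/-! ### Looking a variable up -/

/-- Action at each dictionary literal during a lookup of the probe held (reversed) in `x`.
At an index literal (toggle `t` empty): compare it with the probe (`eqXY`); on equality raise
`found` and `hit`. At a rank literal (toggle set): if `hit` is raised, emit the rank digits and
a comma onto `acc`; otherwise discard it. [folklore] -/
def lookAct : Prog :=
  pop K.t fun o => match o with
    | none =>
        eqXY ;;
        pop K.ne (fun o => match o with
          | some _ => skip
          | none => push K.found Γ'.blank ;; push K.h Γ'.blank) ;;
        push K.t Γ'.blank
    | some _ =>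
        pop K.h fun o => match o with
          | some _ => pour K.y K.j1 ;; pop K.j1 (fun _ => skip) ;; pour K.j1 K.acc ;;
              push K.acc Γ'.comma
          | none => clear K.y

/-- `lookup`: one pass over the dictionary in `d` (restored afterwards through `d2`).
[folklore] -/
def lookup : Prog := loop K.d (litPass K.d2 K.y lookAct) ;; pour K.d2 K.d

/-- Parity of the number of processed dictionary literals (toggle `t`). [folklore] -/
def oddB (p : ℕ) : Bool := decide (p % 2 = 1)
/-- The index literal of the probe (rank `i`) has been processed (`found`). [folklore] -/
def foundB (i p : ℕ) : Bool := decide (2 * i < p)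
/-- The index literal of the probe has just been processed (`h`). [folklore] -/
def hitB (i p : ℕ) : Bool := decide (p = 2 * i + 1)
/-- The rank literal of the probe has been processed (rank emitted on `acc`). [folklore] -/
def emitB (i p : ℕ) : Bool := decide (2 * i + 1 < p)

/-- The store during a lookup, as a function of the processed and remaining dictionary
literals; `i` is the rank of the probe (`|vs|` if absent). [folklore] -/
def lkSt (R : Store) (i : ℕ) (done rest : List Lit) : Store :=
  Function.update (Function.update (Function.update (Function.update (Function.update
    (Function.update R K.d (cbody rest)) K.d2 ((cbody done).reverse))
    K.t (uflag (oddB done.length)))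
    K.found (uflag (foundB i done.length)))
    K.h (uflag (hitB i done.length)))
    K.acc ((bif emitB i done.length then Γ'.comma :: (bits i).reverse else []) ++ R K.acc)

/-- Cost of `lookAct` for literal bodies of length `≤ W`. [folklore] -/
def cLookAct (W : ℕ) : ℕ := 24 * W + 21

/-- The rank of the probe determines the position of its index literal. [folklore] -/
theorem two_mul_idxOf_ne_of_ne {vs : List ℕ} {x₀ y : ℕ} {p : ℕ}
    (hget : vs[p / 2]? = some y) (hne : x₀ ≠ y) : 2 * vs.idxOf x₀ ≠ p := by
  intro h
  have hi : vs.idxOf x₀ = p / 2 := by omega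
  have hlt : p / 2 < vs.length := (List.getElem?_eq_some_iff.1 hget).1
  have h1 : vs[p / 2] = y := (List.getElem?_eq_some_iff.1 hget).2
  have h2 : vs[vs.idxOf x₀]'(hi ▸ hlt) = x₀ := List.getElem_idxOf (hi ▸ hlt)
  simp only [hi] at h2
  exact hne (h2.symm.trans h1)

/-- With no duplicates, the index literal of the probe sits at twice its rank. [folklore] -/
theorem two_mul_idxOf_eq {vs : List ℕ} (hvs : vs.Nodup) {x₀ : ℕ} {p : ℕ} (hp : p % 2 = 0)
    (hget : vs[p / 2]? = some x₀) : 2 * vs.idxOf x₀ = p := by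
  have hlt : p / 2 < vs.length := (List.getElem?_eq_some_iff.1 hget).1
  have h1 : vs[p / 2] = x₀ := (List.getElem?_eq_some_iff.1 hget).2
  have : vs.idxOf x₀ = p / 2 := by rw [← h1]; exact hvs.idxOf_getElem _ _
  omega

section LookAct

variable {x₀ W i : ℕ} {R : Store} {done rest : List Lit} {l : Lit}

/-- The store at the action. [folklore] -/
abbrev lkPre (R : Store) (i : ℕ) (done rest : List Lit) (l : Lit) : Store :=
  litPre K.d K.d2 K.y (lkSt R i done (l :: rest)) l rest

/-- Case: the index literal of the probe. [folklore] -/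
theorem runs_lookAct_idx_eq (hy : R K.y = []) (hx : R K.x = (litBody (x₀, true)).reverse)
    (hx2 : R K.x2 = []) (hne : R K.ne = [])
    (hx₀ : (litBody (x₀, true)).length ≤ W) (hl : (litBody l).length ≤ W)
    (hpar : done.length % 2 = 0) (hxl : (x₀, true) = l) (h2i : 2 * i = done.length) :
    Runs lookAct (lkPre R i done rest l) (lkSt R i (done ++ [l]) rest) (cLookAct W) := by
  set p := done.length with hp
  set P := lkPre R i done rest l with hP
  have hPy : P K.y = (litBody l).reverse := by simp [hP, litPre, lkSt, hy]
  have hPx : P K.x = (litBody (x₀, true)).reverse := by simp [hP, litPre, lkSt, hx]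
  have hk : P K.t = [] := by
    have : oddB p = false := by simp [oddB]; omega
    simp [hP, litPre, lkSt, ← hp, this]
  have e1 := runs_eqXY P (by simp [hP, litPre, lkSt, hx2]) (by simp [hP, litPre, lkSt, hne])
  simp only [hPx, hPy, List.length_reverse] at e1
  set P₁ := Function.update (Function.update P K.y []) K.ne
    (Sparsifier.flag ((litBody (x₀, true)).reverse ≠ (litBody l).reverse)) with hP₁
  have hfl : Sparsifier.flag ((litBody (x₀, true)).reverse ≠ (litBody l).reverse) = [] :=
    Sparsifier.flag_false (by rw [hxl]; exact fun h => h rfl)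
  have hk1 : P₁ K.ne = [] := by rw [hP₁]; simp only [Function.update_self]; exact hfl
  set P₂ := Function.update (Function.update P₁ K.found (Γ'.blank :: P₁ K.found)) K.h
    (Γ'.blank :: P₁ K.h) with hP₂
  have e2 : Runs (pop K.ne fun o => match o with
      | some _ => skip
      | none => push K.found Γ'.blank ;; push K.h Γ'.blank) P₁ P₂ 4 := by
    refine (Runs.pop_nil hk1 ((Runs.push K.found Γ'.blank P₁).seq (Runs.push' ?_))).mono
      (by norm_num)
    rw [hP₂]
    simp
  have e3 := Runs.push K.t Γ'.blank P₂
  have hrun : Runs lookAct P (Function.update P₂ K.t (Γ'.blank :: P₂ K.t))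
      (12 * ((litBody (x₀, true)).length + (litBody l).length) + 12 + (4 + 1) + 2) := by
    unfold lookAct
    refine Runs.pop_nil hk ?_
    exact e1.seq (e2.seq e3)
  refine hrun.of_eq ?_ (by simp only [cLookAct]; omega)
  have t1 : oddB p = false := by simp [oddB]; omega
  have t2 : oddB (p + 1) = true := by simp [oddB]; omega
  have f1 : foundB i p = false := by simp [foundB]; omega
  have f2 : foundB i (p + 1) = true := by simp [foundB]; omega
  have g1 : hitB i p = false := by simp [hitB]; omega
  have g2 : hitB i (p + 1) = true := by simp [hitB]; omega
  have a1 : emitB i p = false := by simp [emitB]; omega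
  have a2 : emitB i (p + 1) = false := by simp [emitB]; omega
  have hlen1 : (done ++ [l]).length = p + 1 := by simp [hp]
  rw [hP₂, hP₁, hP]
  simp only [lkPre, litPre, lkSt, hlen1, ← hp, t1, t2, f1, f2, g1, g2, a1, a2, hfl]
  funext r; cases r <;> simp [hy, hne, cbody_append, cbody_cons]

/-- Case: another index literal. [folklore] -/
theorem runs_lookAct_idx_ne (hy : R K.y = []) (hx : R K.x = (litBody (x₀, true)).reverse)
    (hx2 : R K.x2 = []) (hne : R K.ne = [])
    (hx₀ : (litBody (x₀, true)).length ≤ W) (hl : (litBody l).length ≤ W)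
    (hpar : done.length % 2 = 0) (hxl : (x₀, true) ≠ l) (h2i : 2 * i ≠ done.length) :
    Runs lookAct (lkPre R i done rest l) (lkSt R i (done ++ [l]) rest) (cLookAct W) := by
  set p := done.length with hp
  set P := lkPre R i done rest l with hP
  have hPy : P K.y = (litBody l).reverse := by simp [hP, litPre, lkSt, hy]
  have hPx : P K.x = (litBody (x₀, true)).reverse := by simp [hP, litPre, lkSt, hx]
  have hk : P K.t = [] := by
    have : oddB p = false := by simp [oddB]; omega
    simp [hP, litPre, lkSt, ← hp, this]
  have e1 := runs_eqXY P (by simp [hP, litPre, lkSt, hx2]) (by simp [hP, litPre, lkSt, hne])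
  simp only [hPx, hPy, List.length_reverse] at e1
  set P₁ := Function.update (Function.update P K.y []) K.ne
    (Sparsifier.flag ((litBody (x₀, true)).reverse ≠ (litBody l).reverse)) with hP₁
  have hfl : Sparsifier.flag ((litBody (x₀, true)).reverse ≠ (litBody l).reverse) = [Γ'.blank] :=
    Sparsifier.flag_true (fun h => hxl (litBody_injective (List.reverse_injective h)))
  have hk1 : P₁ K.ne = [Γ'.blank] := by rw [hP₁]; simp only [Function.update_self]; exact hfl
  have e2 : Runs (pop K.ne fun o => match o with
      | some _ => skip
      | none => push K.found Γ'.blank ;; push K.h Γ'.blank) P₁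
      (Function.update P₁ K.ne []) 2 :=
    Runs.pop_cons hk1 ((Runs.skip _).of_eq rfl le_rfl)
  have e3 := Runs.push K.t Γ'.blank (Function.update P₁ K.ne [])
  have hrun : Runs lookAct P (Function.update (Function.update P₁ K.ne []) K.t
      (Γ'.blank :: Function.update P₁ K.ne [] K.t))
      (12 * ((litBody (x₀, true)).length + (litBody l).length) + 12 + (2 + 1) + 2) := by
    unfold lookAct
    refine Runs.pop_nil hk ?_
    exact e1.seq (e2.seq e3)
  refine hrun.of_eq ?_ (by simp only [cLookAct]; omega)
  have t1 : oddB p = false := by simp [oddB]; omega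
  have t2 : oddB (p + 1) = true := by simp [oddB]; omega
  have f12 : foundB i (p + 1) = foundB i p := by simp only [foundB]; congr 1; simp only [eq_iff_iff]; omega
  have g1 : hitB i p = false := by simp [hitB]; omega
  have g2 : hitB i (p + 1) = false := by simp [hitB]; omega
  have a12 : emitB i (p + 1) = emitB i p := by simp only [emitB]; congr 1; simp only [eq_iff_iff]; omega
  have hlen1 : (done ++ [l]).length = p + 1 := by simp [hp]
  rw [hP₁, hP]
  simp only [lkPre, litPre, lkSt, hlen1, ← hp, t1, t2, f12, g1, g2, a12]
  funext r; cases r <;> simp [hy, hne, cbody_append, cbody_cons]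

/-- Case: the rank literal of the probe — emit the rank. [folklore] -/
theorem runs_lookAct_rank_hit (hy : R K.y = []) (hj1 : R K.j1 = [])
    (hl : (litBody l).length ≤ W)
    (hpar : done.length % 2 = 1) (hl1 : l = (done.length / 2, false))
    (hpi : done.length = 2 * i + 1) :
    Runs lookAct (lkPre R i done rest l) (lkSt R i (done ++ [l]) rest) (cLookAct W) := by
  set p := done.length with hp
  set P := lkPre R i done rest l with hP
  have hpi2 : p / 2 = i := by omega
  have hPy : P K.y = (litBody l).reverse := by simp [hP, litPre, lkSt, hy]
  have hk : P K.t = [Γ'.blank] := by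
    have : oddB p = true := by simp [oddB]; omega
    simp [hP, litPre, lkSt, ← hp, this]
  have hk1 : Function.update P K.t [] K.h = [Γ'.blank] := by
    have : hitB i p = true := by simp [hitB]; omega
    simp [hP, litPre, lkSt, ← hp, this]
  set Q := Function.update (Function.update P K.t []) K.h [] with hQ
  have e1 := runs_pour (a := K.y) (b := K.j1) (by decide) Q
  have hQy : Q K.y = (litBody l).reverse := by simp [hQ, hPy]
  have hQj1 : Q K.j1 = [] := by simp [hQ, hP, litPre, lkSt, hj1]
  rw [hQy, hQj1, List.length_reverse, List.reverse_reverse, List.append_nil] at e1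
  set Q₁ := Function.update (Function.update Q K.y []) K.j1 (litBody l) with hQ₁
  have hQ₁j1 : Q₁ K.j1 = Γ'.bit false :: bits i := by simp [hQ₁, hl1, litBody_eq, hpi2]
  have e2 : Runs (pop K.j1 fun _ => skip) Q₁ (Function.update Q₁ K.j1 (bits i)) 2 :=
    Runs.pop_cons hQ₁j1 ((Runs.skip _).of_eq rfl le_rfl)
  set Q₂ := Function.update Q₁ K.j1 (bits i) with hQ₂
  have e3 := runs_pour (a := K.j1) (b := K.acc) (by decide) Q₂
  have hQ₂j1 : Q₂ K.j1 = bits i := by simp [hQ₂]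
  have ha1 : emitB i p = false := by simp [emitB]; omega
  have hQ₂acc : Q₂ K.acc = R K.acc := by
    simp [hQ₂, hQ₁, hQ, hP, litPre, lkSt, ← hp, ha1]
  rw [hQ₂j1, hQ₂acc] at e3
  set Q₃ := Function.update (Function.update Q₂ K.j1 []) K.acc ((bits i).reverse ++ R K.acc)
    with hQ₃
  have e4 := Runs.push K.acc Γ'.comma Q₃
  have hrun : Runs lookAct P (Function.update Q₃ K.acc (Γ'.comma :: Q₃ K.acc))
      (3 * (litBody l).length + 1 + (2 + (3 * (bits i).length + 1 + 1)) + 2 + 2) := by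
    unfold lookAct
    refine Runs.pop_cons hk ?_
    refine Runs.pop_cons hk1 ?_
    exact e1.seq (e2.seq (e3.seq e4))
  have hbits : (bits i).length + 1 = (litBody l).length := by simp [hl1, litBody_eq, hpi2]
  refine hrun.of_eq ?_ (by simp only [cLookAct]; omega)
  have t1 : oddB p = true := by simp [oddB]; omega
  have t2 : oddB (p + 1) = false := by simp [oddB]; omega
  have f1 : foundB i p = true := by simp [foundB]; omega
  have f2 : foundB i (p + 1) = true := by simp [foundB]; omega
  have g1 : hitB i p = true := by simp [hitB]; omega
  have g2 : hitB i (p + 1) = false := by simp [hitB]; omega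
  have a2 : emitB i (p + 1) = true := by simp [emitB]; omega
  have hlen1 : (done ++ [l]).length = p + 1 := by simp [hp]
  rw [hQ₃, hQ₂, hQ₁, hQ, hP]
  simp only [lkPre, litPre, lkSt, hlen1, ← hp, t1, t2, f1, f2, g1, g2, ha1, a2]
  funext r; cases r <;> simp [hy, hj1, cbody_append, cbody_cons]

/-- Case: another rank literal — discard it. [folklore] -/
theorem runs_lookAct_rank_miss (hy : R K.y = []) (hl : (litBody l).length ≤ W)
    (hpar : done.length % 2 = 1) (hpi : done.length ≠ 2 * i + 1) :
    Runs lookAct (lkPre R i done rest l) (lkSt R i (done ++ [l]) rest) (cLookAct W) := by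
  set p := done.length with hp
  set P := lkPre R i done rest l with hP
  have hPy : P K.y = (litBody l).reverse := by simp [hP, litPre, lkSt, hy]
  have hk : P K.t = [Γ'.blank] := by
    have : oddB p = true := by simp [oddB]; omega
    simp [hP, litPre, lkSt, ← hp, this]
  have hk1 : Function.update P K.t [] K.h = [] := by
    have : hitB i p = false := by simp [hitB]; omega
    simp [hP, litPre, lkSt, ← hp, this]
  have e1 := runs_clear K.y (Function.update P K.t [])
  have hy' : Function.update P K.t [] K.y = (litBody l).reverse := by simp [hPy]
  rw [hy', List.length_reverse] at e1
  have hrun : Runs lookAct P (Function.update (Function.update P K.t []) K.y [])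
      (2 * (litBody l).length + 1 + 2 + 2) := by
    unfold lookAct
    refine Runs.pop_cons hk ?_
    refine Runs.pop_nil hk1 ?_
    exact e1
  refine hrun.of_eq ?_ (by simp only [cLookAct]; omega)
  have t1 : oddB p = true := by simp [oddB]; omega
  have t2 : oddB (p + 1) = false := by simp [oddB]; omega
  have f12 : foundB i (p + 1) = foundB i p := by simp only [foundB]; congr 1; simp only [eq_iff_iff]; omega
  have g1 : hitB i p = false := by simp [hitB]; omega
  have g2 : hitB i (p + 1) = false := by simp [hitB]; omega
  have a12 : emitB i (p + 1) = emitB i p := by simp only [emitB]; congr 1; simp only [eq_iff_iff]; omega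
  have hlen1 : (done ++ [l]).length = p + 1 := by simp [hp]
  rw [hP]
  simp only [lkPre, litPre, lkSt, hlen1, ← hp, t1, t2, f12, g1, g2, a12]
  funext r; cases r <;> simp [hy, cbody_append, cbody_cons]

end LookAct

/-- **The lookup action.** One step of the invariant `lkSt`. [folklore] -/
theorem runs_lookAct (vs : List ℕ) (hvs : vs.Nodup) (x₀ : ℕ) (W : ℕ)
    (hx₀ : (litBody (x₀, true)).length ≤ W) (R : Store)
    (hy : R K.y = []) (hx : R K.x = (litBody (x₀, true)).reverse) (hx2 : R K.x2 = [])
    (hne : R K.ne = []) (hj1 : R K.j1 = []) (done rest : List Lit) (l : Lit)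
    (hfull : done ++ l :: rest = dictLits 0 vs) (hl : (litBody l).length ≤ W) :
    Runs lookAct (litPre K.d K.d2 K.y (lkSt R (vs.idxOf x₀) done (l :: rest)) l rest)
      (lkSt R (vs.idxOf x₀) (done ++ [l]) rest) (cLookAct W) := by
  rcases dictLits_split vs 0 done rest l hfull with ⟨hpar, hl2, hget⟩ | ⟨hpar, hleq⟩
  · by_cases hxl : x₀ = l.1
    · have hxl' : (x₀, true) = l := Prod.ext hxl (by simp [hl2])
      exact runs_lookAct_idx_eq hy hx hx2 hne hx₀ hl hpar hxl'
        (two_mul_idxOf_eq hvs hpar (hxl ▸ hget))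
    · have hxl' : (x₀, true) ≠ l := fun h => hxl (by rw [← h])
      exact runs_lookAct_idx_ne hy hx hx2 hne hx₀ hl hpar hxl' (two_mul_idxOf_ne_of_ne hget hxl)
  · have hl1 : l = (done.length / 2, false) := by simpa using hleq
    by_cases hpi : done.length = 2 * vs.idxOf x₀ + 1
    · exact runs_lookAct_rank_hit hy hj1 hl hpar hl1 hpi
    · exact runs_lookAct_rank_miss hy hl hpar hpi

/-- Cost of `lookup` over a dictionary of `n` variables with literal bodies of length `≤ W`.
[folklore] -/
def cLookup (W n : ℕ) : ℕ := (4 * W + cLookAct W + 3) * (2 * n) + 3 * ((W + 1) * (2 * n)) + 2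

/-- **Specification of `lookup`.** With the dictionary of `vs` in `d`, the probe `(x₀, true)`
reversed in `x` and clean scratch registers, `lookup` restores `d`, raises `found` iff `x₀ ∈ vs`,
and in that case emits the digits of the rank of `x₀` followed by a comma onto `acc`.
[folklore] -/
theorem runs_lookup (vs : List ℕ) (hvs : vs.Nodup) (x₀ W : ℕ)
    (hW : ∀ l ∈ dictLits 0 vs, (litBody l).length ≤ W) (hx₀ : (litBody (x₀, true)).length ≤ W)
    (R : Store) (hd : R K.d = cbody (dictLits 0 vs)) (hd2 : R K.d2 = []) (hy : R K.y = [])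
    (hx : R K.x = (litBody (x₀, true)).reverse) (hx2 : R K.x2 = []) (hne : R K.ne = [])
    (hj1 : R K.j1 = []) (ht : R K.t = []) (hfound : R K.found = []) (hh : R K.h = []) :
    Runs lookup R (Function.update (Function.update R K.found (uflag (decide (x₀ ∈ vs)))) K.acc
      ((bif decide (x₀ ∈ vs) then Γ'.comma :: (bits (vs.idxOf x₀)).reverse else []) ++ R K.acc))
      (cLookup W vs.length) := by
  set i := vs.idxOf x₀ with hi
  set full := dictLits 0 vs with hfull
  unfold lookup
  have hpass := runs_litPass (reg := K.d) (sv := K.d2) (ac := K.y) lookAct (by decide)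
    (by decide) (by decide) (lkSt R i) full W (cLookAct W)
    (fun done rest => by simp [lkSt])
    (fun done rest => by simp [lkSt, hy])
    (fun done l rest hsplit hl => runs_lookAct vs hvs x₀ W hx₀ R hy hx hx2 hne hj1 done rest l
      (by rw [hsplit]) hl)
    full [] rfl hW
  have hSt0 : lkSt R i [] full = R := by
    have t0 : oddB 0 = false := by simp [oddB]
    have f0 : foundB i 0 = false := by simp [foundB]
    have g0 : hitB i 0 = false := by simp [hitB]
    have a0 : emitB i 0 = false := by simp [emitB]
    funext r; cases r <;> simp [lkSt, t0, f0, g0, a0, hd, hd2, ht, hfound, hh, hfull]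
  rw [hSt0, List.nil_append] at hpass
  set T₁ := lkSt R i full [] with hT₁
  have e2 := runs_pour (a := K.d2) (b := K.d) (by decide) T₁
  have hT₁d2 : T₁ K.d2 = (cbody full).reverse := by simp [hT₁, lkSt]
  have hT₁d : T₁ K.d = [] := by simp [hT₁, lkSt]
  rw [hT₁d2, hT₁d, List.length_reverse, List.reverse_reverse, List.append_nil] at e2
  have hn : full.length = 2 * vs.length := by rw [hfull, length_dictLits]
  have hlen : (cbody full).length ≤ (W + 1) * full.length := length_cbody_le hW
  rw [hn] at hlen hpass
  refine (hpass.seq e2).of_eq ?_ ?_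
  · have hmem : (x₀ ∈ vs) ↔ i < vs.length := by rw [hi]; exact List.idxOf_lt_length_iff.symm
    have t1 : oddB full.length = false := by simp [oddB, hn]
    have f1 : foundB i full.length = decide (x₀ ∈ vs) := by
      simp only [foundB, hn]; congr 1; rw [eq_iff_iff, hmem]; omega
    have g1 : hitB i full.length = false := by simp [hitB, hn]; omega
    have a1 : emitB i full.length = decide (x₀ ∈ vs) := by
      simp only [emitB, hn]; congr 1; rw [eq_iff_iff, hmem]; omega
    rw [hT₁]
    simp only [lkSt, t1, f1, g1, a1]
    funext r; cases r <;> simp [hd, hd2, ht, hh]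
  · simp only [cLookup]
    omega

/-! ### First occurrences: the list-level model of the renaming -/

/-- The distinct variables of a list of literals, in order of first occurrence. [folklore] -/
def pvars (P : List Lit) : List ℕ := (P.map Prod.fst).eraseDups

/-- `eraseDups` of a list extended by one element. [folklore] -/
theorem eraseDups_append_singleton {α : Type*} [DecidableEq α] :
    ∀ (l : List α) (x : α),
      (l ++ [x]).eraseDups = if x ∈ l then l.eraseDups else l.eraseDups ++ [x] := by
  intro l
  induction' hn : l.length using Nat.strong_induction_on with n ih generalizing l
  intro x
  cases l with
  | nil => simp [List.eraseDups_cons]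
  | cons a l =>
    subst hn
    rw [List.cons_append, List.eraseDups_cons, List.eraseDups_cons, List.filter_append]
    by_cases hxa : x = a
    · subst hxa
      have hf : List.filter (fun b => !b == x) [x] = [] := by simp
      rw [hf, List.append_nil, if_pos List.mem_cons_self]
    · have hf : List.filter (fun b => !b == a) [x] = [x] := by simp [hxa]
      rw [hf]
      have hlt : (List.filter (fun b => !b == a) l).length < (a :: l).length :=
        Nat.lt_succ_of_le (List.length_filter_le _ _)
      rw [ih _ hlt _ rfl x]
      have hmem : (x ∈ List.filter (fun b => !b == a) l) ↔ x ∈ l := by simp [hxa]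
      by_cases hx : x ∈ l
      · rw [if_pos (hmem.2 hx), if_pos (List.mem_cons_of_mem _ hx)]
      · rw [if_neg (fun h => hx (hmem.1 h)), if_neg (by simp [hxa, hx])]
        simp

/-- The index of an element of `P` in `eraseDups (P ++ Q)` is its index in `eraseDups P`.
[folklore] -/
theorem idxOf_eraseDups_append {α : Type*} [DecidableEq α] :
    ∀ (P Q : List α) (x : α), x ∈ P → (P ++ Q).eraseDups.idxOf x = P.eraseDups.idxOf x := by
  intro P
  induction' hn : P.length using Nat.strong_induction_on with n ih generalizing P
  intro Q x hx
  cases P with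
  | nil => simp at hx
  | cons a P =>
    subst hn
    rw [List.cons_append, List.eraseDups_cons, List.eraseDups_cons]
    by_cases hxa : x = a
    · subst hxa; simp
    · rw [List.idxOf_cons_ne _ (Ne.symm hxa), List.idxOf_cons_ne _ (Ne.symm hxa), List.filter_append]
      have hlt : (List.filter (fun b => !b == a) P).length < (a :: P).length :=
        Nat.lt_succ_of_le (List.length_filter_le _ _)
      have hx' : x ∈ List.filter (fun b => !b == a) P := by
        simp only [List.mem_filter]
        exact ⟨(List.mem_cons.1 hx).resolve_left hxa, by simp [hxa]⟩
      rw [ih _ hlt _ rfl _ x hx']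

/-- `pvars` of a prefix extended by a seen variable. [folklore] -/
theorem pvars_append_of_mem {P : List Lit} {l : Lit} (h : l.1 ∈ pvars P) :
    pvars (P ++ [l]) = pvars P := by
  unfold pvars at *
  rw [List.map_append, List.map_singleton, eraseDups_append_singleton,
    if_pos (List.mem_eraseDups.1 h)]

/-- `pvars` of a prefix extended by a new variable. [folklore] -/
theorem pvars_append_of_not_mem {P : List Lit} {l : Lit} (h : l.1 ∉ pvars P) :
    pvars (P ++ [l]) = pvars P ++ [l.1] := by
  unfold pvars at *
  rw [List.map_append, List.map_singleton, eraseDups_append_singleton,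
    if_neg (fun h' => h (List.mem_eraseDups.2 h'))]

/-- `pvars` has no duplicates. [folklore] -/
theorem nodup_pvars (P : List Lit) : (pvars P).Nodup := IPRename.nodup_eraseDups _

/-- The rank assigned to the variable of `l` when it is met after the literals `P`. [folklore] -/
def rk (P : List Lit) (l : Lit) : ℕ := (pvars (P ++ [l])).idxOf l.1

/-- The rank of a seen variable is its position in the dictionary. [folklore] -/
theorem rk_of_mem {P : List Lit} {l : Lit} (h : l.1 ∈ pvars P) : rk P l = (pvars P).idxOf l.1 := by
  rw [rk, pvars_append_of_mem h]

/-- The rank of a new variable is the size of the dictionary. [folklore] -/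
theorem rk_of_not_mem {P : List Lit} {l : Lit} (h : l.1 ∉ pvars P) :
    rk P l = (pvars P).length := by
  rw [rk, pvars_append_of_not_mem h, List.idxOf_append_of_notMem h]
  simp

/-- **Ranks are final**: the rank assigned when a variable is met is its rank in the complete
list of first occurrences. [folklore] -/
theorem rk_eq_idxOf (P S : List Lit) (l : Lit) :
    rk P l = (pvars (P ++ l :: S)).idxOf l.1 := by
  have e : P ++ l :: S = (P ++ [l]) ++ S := by simp
  rw [rk, e, pvars, pvars, List.map_append (f := Prod.fst) (l₁ := P ++ [l]) (l₂ := S),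
    idxOf_eraseDups_append]
  simp

/-- The renamed literals of a clause `c` met after the literals `G`. [folklore] -/
def outLits : List Lit → List Lit → List Lit
  | _, [] => []
  | G, l :: rest => (rk G l, l.2) :: outLits (G ++ [l]) rest

/-- `outLits` of an extended clause. [folklore] -/
theorem outLits_append_singleton : ∀ (G done : List Lit) (l : Lit),
    outLits G (done ++ [l]) = outLits G done ++ [(rk (G ++ done) l, l.2)]
  | G, [], l => by simp [outLits]
  | G, a :: done, l => by
    simp only [List.cons_append, outLits, outLits_append_singleton (G ++ [a]) done l,
      List.append_assoc, List.nil_append]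

/-- The renamed clauses met after the literals `G`. [folklore] -/
def outF : List Lit → List (List Lit) → List (List Lit)
  | _, [] => []
  | G, c :: rest => outLits G c :: outF (G ++ c) rest

/-- `outF` of an extended clause list. [folklore] -/
theorem outF_append_singleton : ∀ (G : List Lit) (done : List (List Lit)) (c : List Lit),
    outF G (done ++ [c]) = outF G done ++ [outLits (G ++ done.flatten) c]
  | G, [], c => by simp [outF]
  | G, a :: done, c => by
    simp only [List.cons_append, outF, outF_append_singleton (G ++ a) done c, List.flatten_cons,
      List.append_assoc]

/-- **The list-level model is the renaming by first occurrence.** [folklore] -/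
theorem outLits_eq_map (G : List Lit) : ∀ (c S : List Lit), 
    outLits G c = c.map fun l => ((pvars (G ++ c ++ S)).idxOf l.1, l.2)
  | [], S => by simp [outLits]
  | l :: c, S => by
    simp only [outLits, List.map_cons, List.cons.injEq, Prod.mk.injEq, and_true]
    constructor
    · rw [rk_eq_idxOf G (c ++ S) l]; simp
    · rw [outLits_eq_map (G ++ [l]) c S]; simp

/-- The model on a clause list. [folklore] -/
theorem outF_eq_map : ∀ (G : List Lit) (F : List (List Lit)) (S : List Lit),
    outF G F = F.map fun c => c.map fun l => ((pvars (G ++ F.flatten ++ S)).idxOf l.1, l.2)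
  | G, [], S => by simp [outF]
  | G, c :: F, S => by
    simp only [outF, List.map_cons, List.flatten_cons, List.cons.injEq]
    constructor
    · rw [outLits_eq_map G c (F.flatten ++ S)]; simp
    · rw [outF_eq_map (G ++ c) F S]; simp

/-- `occList` is `pvars` of the flattened clause list. [folklore] -/
theorem occList_eq_pvars (F : List (List Lit)) : IPRename.occList F = pvars F.flatten := by
  rw [IPRename.occList, pvars, List.map_flatten]
  rfl

/-! ### A new variable: emit its rank, extend the dictionary, count -/

/-- `newEntry`: the probe `(x₀, true)` (reversed in `x`) is a new variable of rank `m` (the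
counter): emit the digits of `m` and a comma onto `acc`, append the entry `(x₀, true), (m, false)`
to the dictionary, and increment the counter. [folklore] -/
def newEntry : Prog :=
  emitCnt K.acc ;; push K.acc Γ'.comma ;;
  pour K.d K.j4 ;; pour K.x K.j1 ;; pour K.j1 K.j4 ;; push K.j4 Γ'.comma ;;
  push K.j4 (Γ'.bit false) ;; emitCnt K.j4 ;; push K.j4 Γ'.comma ;; pour K.j4 K.d ;; incr

/-- Cost of `newEntry` (`W` bounds the literal bodies and the counter, `n` the dictionary).
[folklore] -/
def cNewEntry (W n : ℕ) : ℕ := 47 * W + 6 * ((W + 1) * (2 * n)) + 9 * n + 43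

/-- The scratch registers of the literal routines are empty. [folklore] -/
structure Scratch (R : Store) : Prop where
  (j1 : R K.j1 = []) (j2 : R K.j2 = []) (j3 : R K.j3 = []) (j4 : R K.j4 = [])
  (fl : R K.fl = []) (y : R K.y = []) (x2 : R K.x2 = []) (ne : R K.ne = [])
  (t : R K.t = []) (found : R K.found = []) (h : R K.h = []) (d2 : R K.d2 = [])

/-- **Specification of `newEntry`.** [folklore] -/
theorem runs_newEntry (vs : List ℕ) (x₀ W : ℕ) (R : Store) (hS : Scratch R)
    (hW : ∀ l ∈ dictLits 0 vs, (litBody l).length ≤ W) (hx₀ : (litBody (x₀, true)).length ≤ W)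
    (hcW : (bits vs.length).length + 1 ≤ W)
    (hd : R K.d = cbody (dictLits 0 vs)) (hx : R K.x = (litBody (x₀, true)).reverse)
    (hcnt : R K.cnt = bits vs.length) :
    Runs newEntry R
      (Function.update (Function.update (Function.update (Function.update R
        K.acc (Γ'.comma :: (bits vs.length).reverse ++ R K.acc))
        K.d (cbody (dictLits 0 (vs ++ [x₀]))))
        K.x [])
        K.cnt (bits (vs.length + 1)))
      (cNewEntry W vs.length) := by
  obtain ⟨hj1, hj2, hj3, hj4, hfl, hy, hx2, hne, ht, hfound, hh, hd2⟩ := hS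
  set D := dictLits 0 vs with hD
  set m := vs.length with hm
  have hDlen : (cbody D).length ≤ (W + 1) * (2 * m) := by
    have h := length_cbody_le hW
    rw [hD, length_dictLits] at h
    rw [hm, hD]; exact h
  unfold newEntry
  -- emit the rank
  have e1 := runs_emitCnt (dst := K.acc) (by decide) (by decide) (by decide) (by decide) R hj1 hj2 hj3
  rw [hcnt] at e1
  set R₁ := Function.update R K.acc ((bits m).reverse ++ R K.acc) with hR₁
  have e2 := Runs.push K.acc Γ'.comma R₁
  set R₂ := Function.update R₁ K.acc (Γ'.comma :: R₁ K.acc) with hR₂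
  -- move the dictionary aside
  have e3 := runs_pour (a := K.d) (b := K.j4) (by decide) R₂
  have h3a : R₂ K.d = cbody D := by simp [hR₂, hR₁, hd, hD]
  have h3b : R₂ K.j4 = [] := by simp [hR₂, hR₁, hj4]
  rw [h3a, h3b, List.append_nil] at e3
  set R₃ := Function.update (Function.update R₂ K.d []) K.j4 (cbody D).reverse with hR₃
  -- the probe, in reading order
  have e4 := runs_pour (a := K.x) (b := K.j1) (by decide) R₃
  have h4a : R₃ K.x = (litBody (x₀, true)).reverse := by simp [hR₃, hR₂, hR₁, hx]
  have h4b : R₃ K.j1 = [] := by simp [hR₃, hR₂, hR₁, hj1]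
  rw [h4a, h4b, List.length_reverse, List.reverse_reverse, List.append_nil] at e4
  set R₄ := Function.update (Function.update R₃ K.x []) K.j1 (litBody (x₀, true)) with hR₄
  have e5 := runs_pour (a := K.j1) (b := K.j4) (by decide) R₄
  have h5a : R₄ K.j1 = litBody (x₀, true) := by simp [hR₄]
  have h5b : R₄ K.j4 = (cbody D).reverse := by simp [hR₄, hR₃]
  rw [h5a, h5b] at e5
  set R₅ := Function.update (Function.update R₄ K.j1 []) K.j4
    ((litBody (x₀, true)).reverse ++ (cbody D).reverse) with hR₅
  have e6 := Runs.push K.j4 Γ'.comma R₅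
  set R₆ := Function.update R₅ K.j4 (Γ'.comma :: R₅ K.j4) with hR₆
  have e7 := Runs.push K.j4 (Γ'.bit false) R₆
  set R₇ := Function.update R₆ K.j4 (Γ'.bit false :: R₆ K.j4) with hR₇
  -- the rank digits of the entry
  have e8 := runs_emitCnt (dst := K.j4) (by decide) (by decide) (by decide) (by decide) R₇
    (by simp [hR₇, hR₆, hR₅]) (by simp [hR₇, hR₆, hR₅, hR₄, hR₃, hR₂, hR₁, hj2])
    (by simp [hR₇, hR₆, hR₅, hR₄, hR₃, hR₂, hR₁, hj3])
  have h8 : R₇ K.cnt = bits m := by simp [hR₇, hR₆, hR₅, hR₄, hR₃, hR₂, hR₁, hcnt, hm]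
  rw [h8] at e8
  set R₈ := Function.update R₇ K.j4 ((bits m).reverse ++ R₇ K.j4) with hR₈
  have e9 := Runs.push K.j4 Γ'.comma R₈
  set R₉ := Function.update R₈ K.j4 (Γ'.comma :: R₈ K.j4) with hR₉
  -- the extended dictionary, back in `d`
  have hR₉j4 : R₉ K.j4 = (cbody (dictLits 0 (vs ++ [x₀]))).reverse := by
    simp [hR₉, hR₈, hR₇, hR₆, hR₅, dictLits_append_singleton, cbody_append, cbody_cons,
      litBody_eq, hD, hm]
  have e10 := runs_pour (a := K.j4) (b := K.d) (by decide) R₉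
  have h10 : R₉ K.d = [] := by simp [hR₉, hR₈, hR₇, hR₆, hR₅, hR₄, hR₃]
  rw [hR₉j4, h10, List.length_reverse, List.reverse_reverse, List.append_nil] at e10
  set R₁₀ := Function.update (Function.update R₉ K.j4 []) K.d (cbody (dictLits 0 (vs ++ [x₀])))
    with hR₁₀
  -- count
  have e11 := runs_incr_bits m R₁₀
    (by simp [hR₁₀, hR₉, hR₈, hR₇, hR₆, hR₅, hR₄, hR₃, hR₂, hR₁, hcnt, hm])
    (by simp [hR₁₀, hR₉, hR₈, hR₇, hR₆, hR₅, hR₄, hR₃, hR₂, hR₁, hfl])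
    (by simp [hR₁₀, hR₉, hR₈, hR₇, hR₆, hR₅])
  refine (e1.seq (e2.seq (e3.seq (e4.seq (e5.seq (e6.seq (e7.seq (e8.seq (e9.seq
    (e10.seq e11)))))))))).of_eq ?_ ?_
  · rw [hR₁₀, hR₉, hR₈, hR₇, hR₆, hR₅, hR₄, hR₃, hR₂, hR₁]
    funext r; cases r <;> simp [hj1, hj4, hD]
  · have hlx : (bits x₀).length + 1 ≤ W := by simpa [litBody_eq] using hx₀
    have hb : (bits m).length + 1 ≤ W := hcW
    have hlen10 : (cbody (dictLits 0 (vs ++ [x₀]))).length =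
        (cbody D).length + (bits x₀).length + (bits m).length + 4 := by
      simp [dictLits_append_singleton, cbody_append, cbody_cons, litBody_eq, hD, hm]; omega
    have hlx' : (litBody (x₀, true)).length = (bits x₀).length + 1 := by simp [litBody_eq]
    rw [hlen10, hlx']
    simp only [cNewEntry]
    omega

/-! ### Processing one literal of the input -/

/-- `litAct`: the action at each literal `(x₀, b)` of the input (accumulated reversed in `x`):
emit the polarity digit, normalise the probe to `(x₀, true)`, look it up, and either discard the
probe (seen variable; its rank has been emitted) or register it as a new variable. [folklore] -/
def litAct : Prog :=
  pour K.x K.j1 ;;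
  pop K.j1 (fun o => match o with
    | some a => push K.acc a ;; push K.x (Γ'.bit true) ;; pour K.j1 K.x
    | none => skip) ;;
  lookup ;;
  pop K.found (fun o => match o with
    | some _ => clear K.x
    | none => newEntry)

/-- Cost of `litAct`. [folklore] -/
def cLitAct (W n : ℕ) : ℕ := 10 * W + 9 + cLookup W n + cNewEntry W n

/-- The dictionary after meeting `x₀`. [folklore] -/
def vsAfter (vs : List ℕ) (x₀ : ℕ) : List ℕ := if x₀ ∈ vs then vs else vs ++ [x₀]

/-- The rank of `x₀` with respect to the dictionary `vs`. [folklore] -/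
def rankIn (vs : List ℕ) (x₀ : ℕ) : ℕ := if x₀ ∈ vs then vs.idxOf x₀ else vs.length

/-- **Specification of `litAct`.** With the dictionary of `vs` in `d`, the counter `bits |vs|`,
the literal `(x₀, b)` reversed in `x` and clean scratch registers, `litAct` empties `x`, emits
`encodeLiteral (rankIn vs x₀, b)` (reversed) onto `acc`, and updates dictionary and counter to
`vsAfter vs x₀`. [folklore] -/
theorem runs_litAct (vs : List ℕ) (hvs : vs.Nodup) (x₀ : ℕ) (b : Bool) (W : ℕ) (R : Store)
    (hS : Scratch R) (hW : ∀ l ∈ dictLits 0 vs, (litBody l).length ≤ W)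
    (hx₀ : (litBody (x₀, true)).length ≤ W) (hcW : (bits vs.length).length + 1 ≤ W)
    (hd : R K.d = cbody (dictLits 0 vs)) (hx : R K.x = (litBody (x₀, b)).reverse)
    (hcnt : R K.cnt = bits vs.length) :
    Runs litAct R
      (Function.update (Function.update (Function.update (Function.update R
        K.acc ((KCNF.encodeLiteral (rankIn vs x₀, b)).reverse ++ R K.acc))
        K.d (cbody (dictLits 0 (vsAfter vs x₀))))
        K.x [])
        K.cnt (bits (vsAfter vs x₀).length))
      (cLitAct W vs.length) := by
  obtain ⟨hj1, hj2, hj3, hj4, hfl, hy, hx2, hne, ht, hfound, hh, hd2⟩ := hS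
  have hlb : litBody (x₀, b) = Γ'.bit b :: bits x₀ := rfl
  have hlt : litBody (x₀, true) = Γ'.bit true :: bits x₀ := rfl
  have hbx : (bits x₀).length + 1 ≤ W := by simpa [hlt] using hx₀
  unfold litAct
  -- the literal in reading order
  have e1 := runs_pour (a := K.x) (b := K.j1) (by decide) R
  rw [hx, hj1, List.length_reverse, List.reverse_reverse, List.append_nil] at e1
  set R₁ := Function.update (Function.update R K.x []) K.j1 (litBody (x₀, b)) with hR₁
  have hk1 : R₁ K.j1 = Γ'.bit b :: bits x₀ := by simp [hR₁, hlb]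
  -- emit the polarity, normalise the probe
  set R₂ := Function.update (Function.update (Function.update R₁ K.j1 []) K.acc
    (Γ'.bit b :: R K.acc)) K.x (litBody (x₀, true)).reverse with hR₂
  have e2 : Runs (pop K.j1 fun o => match o with
      | some a => push K.acc a ;; push K.x (Γ'.bit true) ;; pour K.j1 K.x
      | none => skip) R₁ R₂ (1 + (1 + (3 * (bits x₀).length + 1)) + 2) := by
    refine Runs.pop_cons hk1 ?_
    have f1 := Runs.push K.acc (Γ'.bit b) (Function.update R₁ K.j1 (bits x₀))
    have f2 := Runs.push K.x (Γ'.bit true)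
      (Function.update (Function.update R₁ K.j1 (bits x₀)) K.acc
        (Γ'.bit b :: Function.update R₁ K.j1 (bits x₀) K.acc))
    set T := Function.update (Function.update (Function.update R₁ K.j1 (bits x₀)) K.acc
        (Γ'.bit b :: Function.update R₁ K.j1 (bits x₀) K.acc)) K.x
        (Γ'.bit true :: (Function.update (Function.update R₁ K.j1 (bits x₀)) K.acc
        (Γ'.bit b :: Function.update R₁ K.j1 (bits x₀) K.acc)) K.x) with hT
    have f3 := runs_pour (a := K.j1) (b := K.x) (by decide) T
    have hTj1 : T K.j1 = bits x₀ := by simp [hT]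
    have hTx : T K.x = [Γ'.bit true] := by simp [hT, hR₁]
    rw [hTj1, hTx] at f3
    refine (f1.seq (f2.seq f3)).of_eq ?_ le_rfl
    rw [hR₂, hT, hR₁]
    funext r; cases r <;> simp [hlt]
  -- look the probe up
  have e3 := runs_lookup vs hvs x₀ W hW hx₀ R₂ (by simp [hR₂, hR₁, hd]) (by simp [hR₂, hR₁, hd2])
    (by simp [hR₂, hR₁, hy]) (by simp [hR₂]) (by simp [hR₂, hR₁, hx2]) (by simp [hR₂, hR₁, hne])
    (by simp [hR₂, hR₁]) (by simp [hR₂, hR₁, ht]) (by simp [hR₂, hR₁, hfound])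
    (by simp [hR₂, hR₁, hh])
  set R₃ := Function.update (Function.update R₂ K.found (uflag (decide (x₀ ∈ vs)))) K.acc
    ((bif decide (x₀ ∈ vs) then Γ'.comma :: (bits (vs.idxOf x₀)).reverse else []) ++ R₂ K.acc)
    with hR₃
  by_cases hm : x₀ ∈ vs
  · -- a seen variable
    have hk3 : R₃ K.found = [Γ'.blank] := by simp [hR₃, hm]
    have e4 := runs_clear K.x (Function.update R₃ K.found [])
    have h4 : Function.update R₃ K.found [] K.x = (litBody (x₀, true)).reverse := by
      simp [hR₃, hR₂]
    rw [h4, List.length_reverse] at e4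
    have hrun : Runs (pop K.found fun o => match o with
        | some _ => clear K.x
        | none => newEntry) R₃
        (Function.update (Function.update R₃ K.found []) K.x [])
        (2 * (litBody (x₀, true)).length + 1 + 2) := Runs.pop_cons hk3 e4
    refine (e1.seq (e2.seq (e3.seq hrun))).of_eq ?_ ?_
    · rw [hR₃, hR₂, hR₁]
      simp only [vsAfter, rankIn, hm, decide_true, cond_true]
      funext r; cases r <;> simp [KCNF.encodeLiteral, bits, hd, hcnt, hfound, hj1]
    · simp only [cLitAct, hlb, hlt, List.length_cons]
      omega
  · -- a new variable
    have hk3 : R₃ K.found = [] := by simp [hR₃, hm]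
    have e4 := runs_newEntry vs x₀ W R₃ ⟨by simp [hR₃, hR₂, hR₁], by simp [hR₃, hR₂, hR₁, hj2],
      by simp [hR₃, hR₂, hR₁, hj3], by simp [hR₃, hR₂, hR₁, hj4], by simp [hR₃, hR₂, hR₁, hfl],
      by simp [hR₃, hR₂, hR₁, hy], by simp [hR₃, hR₂, hR₁, hx2], by simp [hR₃, hR₂, hR₁, hne],
      by simp [hR₃, hR₂, hR₁, ht], hk3, by simp [hR₃, hR₂, hR₁, hh], by simp [hR₃, hR₂, hR₁, hd2]⟩
      hW hx₀ hcW (by simp [hR₃, hR₂, hR₁, hd]) (by simp [hR₃, hR₂, hR₁]) (by simp [hR₃, hR₂, hR₁, hcnt])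
    have hrun : Runs (pop K.found fun o => match o with
        | some _ => clear K.x
        | none => newEntry) R₃ _ (cNewEntry W vs.length + 2) := Runs.pop_nil hk3 e4
    refine (e1.seq (e2.seq (e3.seq hrun))).of_eq ?_ ?_
    · rw [hR₃, hR₂, hR₁]
      simp only [vsAfter, rankIn, hm, decide_false, cond_false, List.nil_append]
      funext r; cases r <;> simp [KCNF.encodeLiteral, bits, hfound, hj1]
    · simp only [cLitAct, hlb, List.length_cons]
      omega

/-- `cLookup` is monotone in the dictionary size. [folklore] -/
theorem cLookup_mono (W : ℕ) {n n' : ℕ} (h : n ≤ n') : cLookup W n ≤ cLookup W n' := by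
  simp only [cLookup]
  have := Nat.mul_le_mul_left (4 * W + cLookAct W + 3) (Nat.mul_le_mul_left 2 h)
  have := Nat.mul_le_mul_left (W + 1) (Nat.mul_le_mul_left 2 h)
  omega

/-- `cNewEntry` is monotone in the dictionary size. [folklore] -/
theorem cNewEntry_mono (W : ℕ) {n n' : ℕ} (h : n ≤ n') : cNewEntry W n ≤ cNewEntry W n' := by
  simp only [cNewEntry]
  have := Nat.mul_le_mul_left (W + 1) (Nat.mul_le_mul_left 2 h)
  omega

/-- `cLitAct` is monotone in the dictionary size. [folklore] -/
theorem cLitAct_mono (W : ℕ) {n n' : ℕ} (h : n ≤ n') : cLitAct W n ≤ cLitAct W n' := by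
  simp only [cLitAct]
  have := cLookup_mono W h
  have := cNewEntry_mono W h
  omega

/-! ### Size bounds -/

/-- The literal body is the index numeral and the polarity. [folklore] -/
theorem length_litBody (l : Lit) : (litBody l).length = (bits l.1).length + 1 := by
  simp [litBody_eq]

/-- The dictionary is no longer than the list of literals. [folklore] -/
theorem length_pvars_le (P : List Lit) : (pvars P).length ≤ P.length := by
  have h1 : (pvars P).length = (P.map Prod.fst).toFinset.card := by
    rw [← List.toFinset_card_of_nodup (nodup_pvars P)]
    congr 1
    ext x
    simp [pvars, List.mem_eraseDups]
  rw [h1]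
  exact (List.toFinset_card_le _).trans (by simp)

/-- Members of the dictionary are variables of the literals. [folklore] -/
theorem mem_pvars_iff {P : List Lit} {x : ℕ} : x ∈ pvars P ↔ ∃ l ∈ P, l.1 = x := by
  simp [pvars, List.mem_eraseDups]

/-- The size assumptions of the literal routines: `W` exceeds every index numeral of the
literals `Full` by two, and their number by two. [folklore] -/
structure GoodW (Full : List Lit) (W : ℕ) : Prop where
  bitsW : ∀ l ∈ Full, (bits l.1).length + 2 ≤ W
  lenW : Full.length + 2 ≤ W

/-- Bounds for the dictionary of a part of the literals. [folklore] -/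
theorem GoodW.dict {Full : List Lit} {W : ℕ} (hG : GoodW Full W) {P : List Lit}
    (hP : ∀ l ∈ P, l ∈ Full) (hPl : P.length ≤ Full.length) :
    ∀ l' ∈ dictLits 0 (pvars P), (litBody l').length ≤ W := by
  intro l' hl'
  rw [length_litBody]
  rcases mem_dictLits 0 (pvars P) l' hl' with ⟨-, h2⟩ | ⟨-, h2⟩
  · obtain ⟨l, hl, hl1⟩ := mem_pvars_iff.1 h2
    have := hG.bitsW l (hP l hl)
    rw [hl1] at this; omega
  · have h3 := length_pvars_le P
    have h4 := TokConv.length_encodeNat_le l'.1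
    have h5 := hG.lenW
    simp only [bits, List.length_map]
    omega

/-- Bound for the counter of a part of the literals. [folklore] -/
theorem GoodW.cnt {Full : List Lit} {W : ℕ} (hG : GoodW Full W) {P : List Lit}
    (hPl : P.length ≤ Full.length) : (bits (pvars P).length).length + 1 ≤ W := by
  have h3 := length_pvars_le P
  have h4 := TokConv.length_encodeNat_le (pvars P).length
  have h5 := hG.lenW
  simp only [bits, List.length_map]
  omega

/-- Bound for a probe. [folklore] -/
theorem GoodW.probe {Full : List Lit} {W : ℕ} (hG : GoodW Full W) {l : Lit} (hl : l ∈ Full) :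
    (litBody (l.1, true)).length ≤ W := by
  rw [length_litBody]; have := hG.bitsW l hl; simp only at this ⊢; omega

/-- Bound for a literal. [folklore] -/
theorem GoodW.lit {Full : List Lit} {W : ℕ} (hG : GoodW Full W) {l : Lit} (hl : l ∈ Full) :
    (litBody l).length ≤ W := by
  rw [length_litBody]; have := hG.bitsW l hl; omega

/-! ### Processing a clause body -/

/-- `rankIn` on a dictionary of first occurrences is the rank `rk`. [folklore] -/
theorem rankIn_pvars (P : List Lit) (l : Lit) : rankIn (pvars P) l.1 = rk P l := by
  unfold rankIn
  split_ifs with h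
  · rw [rk_of_mem h]
  · rw [rk_of_not_mem h]

/-- `vsAfter` on a dictionary of first occurrences extends the prefix. [folklore] -/
theorem vsAfter_pvars (P : List Lit) (l : Lit) : vsAfter (pvars P) l.1 = pvars (P ++ [l]) := by
  unfold vsAfter
  split_ifs with h
  · rw [pvars_append_of_mem h]
  · rw [pvars_append_of_not_mem h]

/-- The store during the pass over a clause body, after the literals `done` (the earlier
literals of the input being `G`). [folklore] -/
def StL (B : Store) (G : List Lit) (done rest : List Lit) : Store :=
  Function.update (Function.update (Function.update (Function.update (Function.update B
    K.c (cbody rest)) K.c2 ((cbody done).reverse ++ B K.c2))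
    K.acc ((cbody (outLits G done)).reverse ++ B K.acc))
    K.d (cbody (dictLits 0 (pvars (G ++ done)))))
    K.cnt (bits (pvars (G ++ done)).length)

/-- **The pass over a clause body.** [folklore] -/
theorem runs_litLoop {Full : List Lit} {W : ℕ} (hG : GoodW Full W) (G c₀ : List Lit)
    (hsub : ∀ l ∈ G ++ c₀, l ∈ Full) (hlen : (G ++ c₀).length ≤ Full.length)
    (B : Store) (hS : Scratch B) (hc : B K.c = cbody c₀) (hc2 : B K.c2 = []) (hx : B K.x = [])
    (hd : B K.d = cbody (dictLits 0 (pvars G))) (hcnt : B K.cnt = bits (pvars G).length) :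
    Runs (loop K.c (litPass K.c2 K.x litAct)) B (StL B G c₀ [])
      ((4 * W + cLitAct W Full.length + 3) * c₀.length + 1) := by
  obtain ⟨hj1, hj2, hj3, hj4, hfl, hy, hx2, hne, ht, hfound, hh, hd2⟩ := hS
  have hpass := runs_litPass (reg := K.c) (sv := K.c2) (ac := K.x) litAct (by decide)
    (by decide) (by decide) (StL B G) c₀ W (cLitAct W Full.length)
    (fun done rest => by simp [StL])
    (fun done rest => by simp [StL, hx])
    (fun done l rest hsplit hl => by
      have hPsub : ∀ l' ∈ G ++ done, l' ∈ Full := fun l' h => hsub l' (by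
        rw [← hsplit]; rcases List.mem_append.1 h with h | h
        · exact List.mem_append_left _ h
        · exact List.mem_append_right _ (List.mem_append_left _ h))
      have hPlen : (G ++ done).length ≤ Full.length := by
        rw [← hsplit] at hlen; simp only [List.length_append, List.length_cons] at hlen ⊢; omega
      have hlF : l ∈ Full := hsub l (by rw [← hsplit]; simp)
      set P := litPre K.c K.c2 K.x (StL B G done (l :: rest)) l rest with hP
      have e := runs_litAct (pvars (G ++ done)) (nodup_pvars _) l.1 l.2 W P
        ⟨by simp [hP, litPre, StL, hj1], by simp [hP, litPre, StL, hj2],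
         by simp [hP, litPre, StL, hj3], by simp [hP, litPre, StL, hj4],
         by simp [hP, litPre, StL, hfl], by simp [hP, litPre, StL, hy],
         by simp [hP, litPre, StL, hx2], by simp [hP, litPre, StL, hne],
         by simp [hP, litPre, StL, ht], by simp [hP, litPre, StL, hfound],
         by simp [hP, litPre, StL, hh], by simp [hP, litPre, StL, hd2]⟩
        (hG.dict hPsub hPlen) (hG.probe hlF) (hG.cnt hPlen)
        (by simp [hP, litPre, StL]) (by simp [hP, litPre, StL, hx]) (by simp [hP, litPre, StL])
      refine e.of_eq ?_ (cLitAct_mono W ((length_pvars_le _).trans hPlen))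
      rw [rankIn_pvars, vsAfter_pvars, hP]
      simp only [litPre, StL, outLits_append_singleton, cbody_append, cbody_cons, List.append_assoc,
        List.reverse_append, List.reverse_cons, encodeLiteral_eq]
      funext r; cases r <;> simp [hx, cbody])
    c₀ [] rfl (fun l hl => hG.lit (hsub l (List.mem_append_right _ hl)))
  have hSt0 : StL B G [] c₀ = B := by
    funext r; cases r <;> simp [StL, hc, hc2, hd, hcnt, outLits]
  rw [hSt0, List.nil_append] at hpass
  exact hpass

/-! ### Processing the clauses -/

/-- `clauseAct`: the action at each clause of the input (its body accumulated reversed in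
`cacc`): open the output clause, process the body literal by literal, close the output clause.
[folklore] -/
def clauseAct : Prog :=
  push K.acc Γ'.bra ;; pour K.cacc K.c ;; loop K.c (litPass K.c2 K.x litAct) ;; clear K.c2 ;;
  push K.acc Γ'.ket

/-- Cost of `clauseAct` for a clause body of length `≤ wc`. [folklore] -/
def cClause (W n wc : ℕ) : ℕ := (4 * W + cLitAct W n + 3) * wc + 5 * wc + 5

/-- The store during the pass over the clauses, after the clauses `done`. [folklore] -/
def StF (B : Store) (done rest : List (List Lit)) : Store :=
  Function.update (Function.update (Function.update (Function.update (Function.update B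
    K.inp (wFam rest)) K.raw ((wFam done).reverse ++ B K.raw))
    K.acc ((wFam (outF [] done)).reverse ++ B K.acc))
    K.d (cbody (dictLits 0 (pvars done.flatten))))
    K.cnt (bits (pvars done.flatten).length)

/-- A clause body is at least as long as the clause. [folklore] -/
theorem length_le_length_cbody (c : List Lit) : c.length ≤ (cbody c).length := by
  induction c with
  | nil => simp
  | cons l c ih => simp only [cbody_cons, List.length_cons, List.length_append]; omega

/-- **The pass over the clauses.** [folklore] -/
theorem runs_clauseLoop (F : List (List Lit)) {W : ℕ} (hG : GoodW F.flatten W) (Wc : ℕ)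
    (hWc : ∀ c ∈ F, (cbody c).length ≤ Wc)
    (B : Store) (hS : Scratch B) (hinp : B K.inp = wFam F) (hraw : B K.raw = [])
    (hcacc : B K.cacc = []) (hc : B K.c = []) (hc2 : B K.c2 = []) (hx : B K.x = [])
    (hd : B K.d = []) (hcnt : B K.cnt = []) :
    Runs (loop K.inp (famPass K.raw K.cacc clauseAct)) B (StF B F [])
      ((4 * Wc + cClause W F.flatten.length Wc + 6) * F.length + 1) := by
  obtain ⟨hj1, hj2, hj3, hj4, hfl, hy, hx2, hne, ht, hfound, hh, hd2⟩ := hS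
  have hpass := runs_famPass (reg := K.inp) (sv := K.raw) (ca := K.cacc) clauseAct (by decide)
    (by decide) (by decide) (StF B) F Wc (cClause W F.flatten.length Wc)
    (fun done rest => by simp [StF])
    (fun done rest => by simp [StF, hcacc])
    (fun done c₀ rest hsplit hcW => by
      set G := done.flatten with hGdef
      have hsub : ∀ l ∈ G ++ c₀, l ∈ F.flatten := by
        intro l hl
        rw [← hsplit, List.flatten_append, List.flatten_cons]
        rcases List.mem_append.1 hl with h | h
        · exact List.mem_append_left _ h
        · exact List.mem_append_right _ (List.mem_append_left _ h)
      have hlen : (G ++ c₀).length ≤ F.flatten.length := by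
        rw [hGdef, ← hsplit, List.flatten_append, List.flatten_cons]
        simp only [List.length_append]; omega
      set P := famPre K.inp K.raw K.cacc (StF B done (c₀ :: rest)) c₀ rest with hP
      unfold clauseAct
      -- open the output clause
      have e1 := Runs.push K.acc Γ'.bra P
      set P₁ := Function.update P K.acc (Γ'.bra :: P K.acc) with hP₁
      -- the body in reading order
      have e2 := runs_pour (a := K.cacc) (b := K.c) (by decide) P₁
      have h2a : P₁ K.cacc = (cbody c₀).reverse := by simp [hP₁, hP, famPre, StF, hcacc]
      have h2b : P₁ K.c = [] := by simp [hP₁, hP, famPre, StF, hc]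
      rw [h2a, h2b, List.length_reverse, List.reverse_reverse, List.append_nil] at e2
      set P₂ := Function.update (Function.update P₁ K.cacc []) K.c (cbody c₀) with hP₂
      -- the literals
      have e3 := runs_litLoop hG G c₀ hsub hlen P₂
        ⟨by simp [hP₂, hP₁, hP, famPre, StF, hj1], by simp [hP₂, hP₁, hP, famPre, StF, hj2],
         by simp [hP₂, hP₁, hP, famPre, StF, hj3], by simp [hP₂, hP₁, hP, famPre, StF, hj4],
         by simp [hP₂, hP₁, hP, famPre, StF, hfl], by simp [hP₂, hP₁, hP, famPre, StF, hy],
         by simp [hP₂, hP₁, hP, famPre, StF, hx2], by simp [hP₂, hP₁, hP, famPre, StF, hne],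
         by simp [hP₂, hP₁, hP, famPre, StF, ht], by simp [hP₂, hP₁, hP, famPre, StF, hfound],
         by simp [hP₂, hP₁, hP, famPre, StF, hh], by simp [hP₂, hP₁, hP, famPre, StF, hd2]⟩
        (by simp [hP₂]) (by simp [hP₂, hP₁, hP, famPre, StF, hc2])
        (by simp [hP₂, hP₁, hP, famPre, StF, hx]) (by simp [hP₂, hP₁, hP, famPre, StF, hGdef])
        (by simp [hP₂, hP₁, hP, famPre, StF, hGdef])
      set P₃ := StL P₂ G c₀ [] with hP₃
      -- drop the saved body, close the output clause
      have e4 := runs_clear K.c2 P₃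
      have h4 : P₃ K.c2 = (cbody c₀).reverse := by
        simp [hP₃, StL, hP₂, hP₁, hP, famPre, StF, hc2]
      rw [h4, List.length_reverse] at e4
      have e5 := Runs.push K.acc Γ'.ket (Function.update P₃ K.c2 [])
      refine (e1.seq (e2.seq (e3.seq (e4.seq e5)))).of_eq ?_ ?_
      · rw [hP₃, hP₂, hP₁, hP]
        simp only [famPre, StF, StL, outF_append_singleton, List.nil_append, wFam_append,
          wFam_cons, wFam_nil, List.flatten_append, List.flatten_cons,
          List.flatten_nil, List.append_nil, ← hGdef]
        funext r; cases r <;> simp [hcacc, hc, hc2, cbody]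
      · have := length_le_length_cbody c₀
        simp only [cClause]
        nlinarith [hcW, this])
    F [] rfl hWc
  have hSt0 : StF B [] F = B := by
    funext r; cases r <;> simp [StF, hinp, hraw, hd, hcnt, outF, pvars, bits,
      Literature.Computability.Complexity.TokConv.encodeNat_zero', wFam]
  rw [hSt0, List.nil_append] at hpass
  exact hpass

/-! ### Assembling the output -/

/-- `finish`: drop the saved input and the dictionary, and write the output: the counter (the
number of variables), a comma, and the renamed clauses. [folklore] -/
def finish : Prog :=
  clear K.raw ;; clear K.d ;; pour K.acc K.out ;; push K.out Γ'.comma ;; pour K.cnt K.j1 ;;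
  pour K.j1 K.out

/-- **Specification of `finish`.** [folklore] -/
theorem runs_finish (R : Store) (hout : R K.out = []) (hj1 : R K.j1 = []) :
    Runs finish R
      (Function.update (Function.update (Function.update (Function.update (Function.update R
        K.raw []) K.d []) K.acc []) K.cnt [])
        K.out (R K.cnt ++ Γ'.comma :: (R K.acc).reverse))
      (2 * (R K.raw).length + 2 * (R K.d).length + 3 * (R K.acc).length + 6 * (R K.cnt).length
        + 6) := by
  unfold finish
  have e1 := runs_clear K.raw R
  set R₁ := Function.update R K.raw [] with hR₁
  have e2 := runs_clear K.d R₁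
  have h2 : R₁ K.d = R K.d := by simp [hR₁]
  rw [h2] at e2
  set R₂ := Function.update R₁ K.d [] with hR₂
  have e3 := runs_pour (a := K.acc) (b := K.out) (by decide) R₂
  have h3a : R₂ K.acc = R K.acc := by simp [hR₂, hR₁]
  have h3b : R₂ K.out = [] := by simp [hR₂, hR₁, hout]
  rw [h3a, h3b, List.append_nil] at e3
  set R₃ := Function.update (Function.update R₂ K.acc []) K.out (R K.acc).reverse with hR₃
  have e4 := Runs.push K.out Γ'.comma R₃
  set R₄ := Function.update R₃ K.out (Γ'.comma :: R₃ K.out) with hR₄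
  have e5 := runs_pour (a := K.cnt) (b := K.j1) (by decide) R₄
  have h5a : R₄ K.cnt = R K.cnt := by simp [hR₄, hR₃, hR₂, hR₁]
  have h5b : R₄ K.j1 = [] := by simp [hR₄, hR₃, hR₂, hR₁, hj1]
  rw [h5a, h5b, List.append_nil] at e5
  set R₅ := Function.update (Function.update R₄ K.cnt []) K.j1 (R K.cnt).reverse with hR₅
  have e6 := runs_pour (a := K.j1) (b := K.out) (by decide) R₅
  have h6a : R₅ K.j1 = (R K.cnt).reverse := by simp [hR₅]
  have h6b : R₅ K.out = Γ'.comma :: (R K.acc).reverse := by simp [hR₅, hR₄, hR₃]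
  rw [h6a, h6b, List.length_reverse, List.reverse_reverse] at e6
  refine (e1.seq (e2.seq (e3.seq (e4.seq (e5.seq e6))))).of_eq ?_ (by omega)
  rw [hR₅, hR₄, hR₃, hR₂, hR₁]
  funext r; cases r <;> simp [hj1]

/-! ### The program -/

/-- The body of the outer loop over the input: header digits are dropped; at the comma closing
the header, the clauses are processed and the output is written. [folklore] -/
def hdrBody (a : Γ') : Prog :=
  match a with
  | Γ'.comma => loop K.inp (famPass K.raw K.cacc clauseAct) ;; finish
  | _ => skip

/-- **The compaction program.** [folklore] -/
def prog : Prog := loop K.inp hdrBody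

/-- The header digits are dropped. [folklore] -/
theorem segRuns_header : ∀ (u : List Bool) (v : List Γ'),
    SegRuns K.inp hdrBody (bw u) (AStore.single K.inp (bw u ++ v)) (AStore.single K.inp v)
      (2 * u.length)
  | [], v => by simpa using SegRuns.nil K.inp hdrBody (AStore.single K.inp v)
  | b :: u, v => by
    have hk : AStore.single K.inp (bw (b :: u) ++ v) K.inp = Γ'.bit b :: (bw u ++ v) := by simp
    have hbody : Runs (hdrBody (Γ'.bit b))
        (Function.update (AStore.single K.inp (bw (b :: u) ++ v)) K.inp (bw u ++ v))
        (AStore.single K.inp (bw u ++ v)) 0 := by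
      refine (Runs.skip _).of_eq ?_ le_rfl
      funext r; cases r <;> simp [AStore.single]
    have := SegRuns.cons hk hbody (segRuns_header u v)
    exact this.of_eq rfl (by simp only [List.length_cons]; omega)

/-- Cost of the program on a formula of encoded length `L` with `q` clauses, `Λ` literal
occurrences and header of length `h`. [folklore] -/
def cProg (L : ℕ) : ℕ :=
  2 * L + ((4 * L + cClause (L + 2) L L + 6) * L + 1) +
    (2 * L + 2 * ((L + 3) * (2 * L)) + 3 * ((L + 3) * L + 2 * L) + 6 * L + 6) + 2 + 1

/-! ### Sizes of the input -/

/-- The length of a clause body, literal by literal. [folklore] -/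
theorem length_cbody (c : List Lit) : (cbody c).length = (c.map fun l => (bits l.1).length + 2).sum := by
  induction c with
  | nil => simp
  | cons l c ih => simp [cbody_cons, ih, length_litBody]; omega

/-- The length of a family word, clause by clause. [folklore] -/
theorem length_wFam (F : List (List Lit)) :
    (wFam F).length = (F.map fun c => (cbody c).length + 2).sum := by
  induction F with
  | nil => simp
  | cons c F ih => simp [wFam_cons, ih]; omega

/-- A clause body is a part of the family word. [folklore] -/
theorem length_cbody_le_wFam {F : List (List Lit)} {c : List Lit} (hc : c ∈ F) :
    (cbody c).length + 2 ≤ (wFam F).length := by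
  rw [length_wFam]
  exact List.single_le_sum (fun _ _ => Nat.zero_le _) _ (List.mem_map.2 ⟨c, hc, rfl⟩)

/-- The index numeral of a literal is a part of the family word. [folklore] -/
theorem length_bits_le_wFam {F : List (List Lit)} {l : Lit} (hl : l ∈ F.flatten) :
    (bits l.1).length + 2 ≤ (wFam F).length := by
  obtain ⟨c, hc, hlc⟩ := List.mem_flatten.1 hl
  refine le_trans ?_ ((Nat.le_add_right _ _).trans (length_cbody_le_wFam hc))
  rw [length_cbody]
  exact List.single_le_sum (fun _ _ => Nat.zero_le _) _ (List.mem_map.2 ⟨l, hlc, rfl⟩)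

/-- The number of literal occurrences is at most the length of the family word. [folklore] -/
theorem length_flatten_le_wFam (F : List (List Lit)) : F.flatten.length ≤ (wFam F).length := by
  rw [length_wFam, List.length_flatten]
  refine List.sum_le_sum fun c _ => ?_
  rw [length_cbody]
  have : c.length ≤ (c.map fun l => (bits l.1).length + 2).sum := by
    calc c.length = (c.map fun _ => 1).sum := by simp
      _ ≤ _ := List.sum_le_sum fun l _ => by omega
  omega

/-- The number of clauses is at most the length of the family word. [folklore] -/
theorem length_le_wFam (F : List (List Lit)) : F.length ≤ (wFam F).length := by
  rw [length_wFam]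
  calc F.length = (F.map fun _ => 1).sum := by simp
    _ ≤ _ := List.sum_le_sum fun c _ => by omega

/-- The encoding of a formula: header, comma, family word. [folklore] -/
theorem encode_eq {k : ℕ} (φ : KCNF k) :
    φ.encode = bits φ.numVars ++ Γ'.comma :: wFam φ.clauses := rfl

/-- The output word: the renamed family. [folklore] -/
theorem length_wFam_outF_le (F : List (List Lit)) :
    (wFam (outF [] F)).length ≤ 2 * F.length + F.flatten.length * (F.flatten.length + 2) := by
  rw [outF_eq_map [] F [], length_wFam]
  simp only [List.nil_append, List.append_nil, List.map_map]
  have key : ∀ G : List (List Lit),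
      (G.map ((fun c => (cbody c).length + 2) ∘ fun c =>
        c.map fun l => ((pvars F.flatten).idxOf l.1, l.2))).sum ≤
        2 * G.length + G.flatten.length * (F.flatten.length + 2) := by
    intro G
    induction G with
    | nil => simp
    | cons c G ih =>
      have h2 : (cbody (c.map fun l => ((pvars F.flatten).idxOf l.1, l.2))).length ≤
          c.length * (F.flatten.length + 2) := by
        rw [length_cbody, List.map_map]
        have : ∀ m ∈ c.map ((fun l => (bits l.1).length + 2) ∘ fun l =>
            ((pvars F.flatten).idxOf l.1, l.2)), m ≤ F.flatten.length + 2 := by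
          intro m hm
          obtain ⟨l, hl, rfl⟩ := List.mem_map.1 hm
          have h3 : (pvars F.flatten).idxOf l.1 ≤ (pvars F.flatten).length := List.idxOf_le_length
          have h4 := length_pvars_le F.flatten
          have h5 := TokConv.length_encodeNat_le ((pvars F.flatten).idxOf l.1)
          simp only [Function.comp, bits, List.length_map]
          omega
        simpa [Nat.mul_comm] using List.sum_le_card_nsmul _ _ this
      simp only [List.map_cons, List.sum_cons, List.length_cons, List.flatten_cons,
        List.length_append, Function.comp] at ih ⊢
      nlinarith
  exact key F

/-! ### The run of the program -/

/-- The output of the program on `φ`: the number `m` of occurring variables, a comma, and the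
clauses with every variable replaced by its rank of first occurrence. [folklore] -/
def compactOut {k : ℕ} (φ : KCNF k) : List Γ' :=
  bits (IPRename.occList φ.clauses).length ++ Γ'.comma ::
    wFam (φ.clauses.map fun c => c.map fun l => ((IPRename.occList φ.clauses).idxOf l.1, l.2))

/-- **The run of the compaction program**: from the encoding of `φ` in `inp` to `compactOut φ`
in `out`, all other registers empty, within `cProg L` steps. [folklore] -/
theorem runs_prog {k : ℕ} (φ : KCNF k) :
    Runs prog (AStore.single K.inp φ.encode) (AStore.single K.out (compactOut φ))
      (cProg φ.encode.length) := by
  set F := φ.clauses with hF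
  set L := φ.encode.length with hL
  have hLeq : L = (bits φ.numVars).length + 1 + (wFam F).length := by
    rw [hL, encode_eq]; simp only [List.length_append, List.length_cons, hF]; omega
  have hwf : (wFam F).length ≤ L := by omega
  -- size assumptions
  have hG : GoodW F.flatten (L + 2) :=
    ⟨fun l hl => by have := length_bits_le_wFam hl; omega,
     by have := length_flatten_le_wFam F; omega⟩
  have hWc : ∀ c ∈ F, (cbody c).length ≤ L := fun c hc => by
    have := length_cbody_le_wFam hc; omega
  have hΛ : F.flatten.length ≤ L := (length_flatten_le_wFam F).trans hwf
  have hq : F.length ≤ L := (length_le_wFam F).trans hwf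
  unfold prog
  -- the header
  have hseg1 := segRuns_header (encodeNat φ.numVars) (Γ'.comma :: wFam F)
  rw [← bits_eq_bw] at hseg1
  -- the clauses and the output
  set B₀ : Store := AStore.single K.inp (wFam F) with hB₀
  have hS : Scratch B₀ := ⟨by simp [hB₀, AStore.single], by simp [hB₀, AStore.single],
    by simp [hB₀, AStore.single], by simp [hB₀, AStore.single], by simp [hB₀, AStore.single],
    by simp [hB₀, AStore.single], by simp [hB₀, AStore.single], by simp [hB₀, AStore.single],
    by simp [hB₀, AStore.single], by simp [hB₀, AStore.single], by simp [hB₀, AStore.single],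
    by simp [hB₀, AStore.single]⟩
  have e1 := runs_clauseLoop F hG L hWc B₀ hS (by simp [hB₀]) (by simp [hB₀, AStore.single])
    (by simp [hB₀, AStore.single]) (by simp [hB₀, AStore.single]) (by simp [hB₀, AStore.single])
    (by simp [hB₀, AStore.single]) (by simp [hB₀, AStore.single]) (by simp [hB₀, AStore.single])
  have e2 := runs_finish (StF B₀ F []) (by simp [StF, hB₀, AStore.single])
    (by simp [StF, hB₀, AStore.single])
  have hbody : Runs (hdrBody Γ'.comma)
      (Function.update (AStore.single K.inp (Γ'.comma :: wFam F)) K.inp (wFam F))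
      (AStore.single K.out (compactOut φ))
      (((4 * L + cClause (L + 2) F.flatten.length L + 6) * F.length + 1) +
        (2 * (StF B₀ F [] K.raw).length + 2 * (StF B₀ F [] K.d).length +
          3 * (StF B₀ F [] K.acc).length + 6 * (StF B₀ F [] K.cnt).length + 6)) := by
    have e0 : Function.update (AStore.single K.inp (Γ'.comma :: wFam F)) K.inp (wFam F) = B₀ := by
      rw [hB₀]; funext r; cases r <;> simp [AStore.single]
    rw [e0]
    unfold hdrBody
    refine (e1.seq e2).of_eq ?_ le_rfl
    rw [hB₀]
    simp only [StF, compactOut, occList_eq_pvars, outF_eq_map [] F [], List.nil_append,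
      List.append_nil, ← hF]
    funext r; cases r <;> simp [AStore.single, wFam]
  have hseg2 := SegRuns.single (f := hdrBody) (R := AStore.single K.inp (Γ'.comma :: wFam F))
    (a := Γ'.comma) (w := wFam F) (by simp) hbody
  have hall := (hseg1.append hseg2).runs_loop_nil (by simp [AStore.single])
  rw [encode_eq, ← hF]
  refine hall.mono ?_
  -- the cost
  have hraw : ((StF B₀ F []) K.raw).length ≤ L := by simp [StF, hB₀, AStore.single]; omega
  have hd : ((StF B₀ F []) K.d).length ≤ (L + 3) * (2 * L) := by
    have h1 : ((StF B₀ F []) K.d).length = (cbody (dictLits 0 (pvars F.flatten))).length := by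
      simp [StF]
    rw [h1]
    refine (length_cbody_le (hG.dict (P := F.flatten) (fun l hl => hl) le_rfl)).trans ?_
    rw [length_dictLits]
    exact Nat.mul_le_mul_left _ (Nat.mul_le_mul_left _ ((length_pvars_le _).trans hΛ))
  have hacc : ((StF B₀ F []) K.acc).length ≤ (L + 3) * L + 2 * L := by
    have h1 : ((StF B₀ F []) K.acc).length = (wFam (outF [] F)).length := by
      simp [StF, hB₀, AStore.single]
    rw [h1]
    refine (length_wFam_outF_le F).trans ?_
    nlinarith [hΛ, hq]
  have hcnt : ((StF B₀ F []) K.cnt).length ≤ L := by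
    have h1 : ((StF B₀ F []) K.cnt).length = (encodeNat (pvars F.flatten).length).length := by
      simp [StF, bits]
    rw [h1]
    exact (TokConv.length_encodeNat_le _).trans ((length_pvars_le _).trans hΛ)
  have hhdr : (encodeNat φ.numVars).length ≤ L := by
    have : (bits φ.numVars).length = (encodeNat φ.numVars).length := by simp [bits]
    omega
  have hcl : (4 * L + cClause (L + 2) F.flatten.length L + 6) * F.length + 1 ≤
      (4 * L + cClause (L + 2) L L + 6) * L + 1 := by
    have h1 : cClause (L + 2) F.flatten.length L ≤ cClause (L + 2) L L := by
      simp only [cClause]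
      have := cLitAct_mono (L + 2) hΛ
      gcongr
    calc (4 * L + cClause (L + 2) F.flatten.length L + 6) * F.length + 1
        ≤ (4 * L + cClause (L + 2) L L + 6) * F.length + 1 := by
          have := Nat.mul_le_mul_right F.length (show 4 * L + cClause (L + 2) F.flatten.length L + 6 ≤
            4 * L + cClause (L + 2) L L + 6 by omega)
          omega
      _ ≤ (4 * L + cClause (L + 2) L L + 6) * L + 1 := by
          have := Nat.mul_le_mul_left (4 * L + cClause (L + 2) L L + 6) hq
          omega
  simp only [cProg]
  omega

/-- **The running time is polynomial**: `cProg L + 1 ≤ 80 (L + 1)^4`. [folklore] -/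
theorem cProg_le (L : ℕ) : cProg L + 1 ≤ 80 * (L + 1) ^ 4 := by
  have e : cProg L = 74 * L ^ 4 + 284 * L ^ 3 + 195 * L ^ 2 + 48 * L + 10 := by
    simp only [cProg, cClause, cLitAct, cLookup, cLookAct, cNewEntry]; ring
  rw [e]
  have e2 : 80 * (L + 1) ^ 4 = 80 * L ^ 4 + 320 * L ^ 3 + 480 * L ^ 2 + 320 * L + 80 := by ring
  rw [e2]
  have := Nat.zero_le (L ^ 4); have := Nat.zero_le (L ^ 3); have := Nat.zero_le (L ^ 2)
  omega

/-- **Compaction is computable in polynomial time**: some multi-stack machine maps `φ.encode` to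
`compactOut φ` within `80 (L + 1)^4` steps. [folklore] -/
theorem computesInTime_compactOut (k : ℕ) :
    Literature.Computability.FineGrained.ComputesInTime KCNF.encode (fun w : List Γ' => w)
      (fun φ : KCNF k => compactOut φ) fun φ => 80 * (φ.encode.length + 1) ^ 4 := by
  obtain ⟨M, hM⟩ := ACom.exists_computesInTime prog K.inp K.out KCNF.encode (fun w : List Γ' => w)
    (fun φ : KCNF k => compactOut φ) (fun φ => cProg φ.encode.length) (fun φ => runs_prog φ)
  refine ⟨M, fun φ => ?_⟩
  exact ⟨⟨(Classical.choice (hM φ)).toEvalsTo, le_trans (Classical.choice (hM φ)).steps_le_m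
    (cProg_le _)⟩⟩

/-! ### Discharge of `kCNF_compact_computable` -/

/-- The output word is the encoding of the compaction `KCNF.compact`. [folklore] -/
theorem compactOut_eq {k : ℕ} (φ : KCNF k) : compactOut φ = φ.compact.encode := rfl

/-- **Discharge of `kCNF_compact_computable`** (`IPLemma2Assembly.lean`): compaction is
computable from `KCNF.encode` to `KCNF.encode` in time `80 (L + 1)^80 ≥ 80 (L + 1)^4`.
[cite: AroraBarak2009, §1.3 (multi-tape machine constructions)] -/
theorem kCNF_compact_computable_holds : kCNF_compact_computable := by
  intro k
  obtain ⟨M, hM⟩ := computesInTime_compactOut k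
  refine ⟨80, M, fun φ => ?_⟩
  obtain ⟨h⟩ := hM φ
  dsimp only at h ⊢
  rw [compactOut_eq] at h
  exact ⟨⟨h.toEvalsTo, h.steps_le_m.trans (Nat.mul_le_mul_left 80
    (Nat.pow_le_pow_right (Nat.succ_pos _) (by norm_num)))⟩⟩

end Literature.Computability.FineGrained.Compaction
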